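import Literature.NumberTheory.LFunctions.ZetaConvexityExplicit
import Literature.NumberTheory.LFunctions.TuringMethod
import HarnessLib

/-!
# Turing's method II: the upper bound of Trudgian 2016 and the reduction of Theorem 1

Topic `Literature/NumberTheory/LFunctions` (trunk T-ANT, family RH).  This file carries out, as
**proved theorems**, the part of T. S. Trudgian, *Improvements to Turing's method II*, Rocky Mountain
J. Math. 46 (2016) 325–332 [Trudgian2016] that is specific to that paper, on top of the tree's
Turing-method infrastructure (`ZetaArgVariation.lean`: Turing's lemma
`Literature.NumberTheory.LFunctions.pi_mul_integral_zetaArgS_eq`; `ZetaConvexityExplicit.lean`: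
Trudgian 2011, Lemmas 2.7–2.8 and the assembly of Thm 2.12;
`Literature/Analysis/Complex/RademacherPhragmenLindelof.lean`: Rademacher's theorem), and reduces
the named fact `Literature.NumberTheory.LFunctions.abs_integral_zetaArgS_le_trudgianII`
(`TuringMethod.lean`; [Trudgian2016, Thm 1]:
`|∫_{t₁}^{t₂} S(t) dt| ≤ 1.698 + 0.183 log log t₂ + 0.049 log t₂` for `t₂ > t₁ > 10⁵`) to its four
genuine inputs.  Everything below is proved; there are no named facts and no definitions.

## Contents

* `abs_integral_zetaArgS_le_of_bounds_loglog(_of_not_ordinate)` — the glue of [Trudgian2016, Thm 2]: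
  bounds `U(t) ≤ a₁ + b₁ log log t + c₁ log t`, `−U(t) ≤ a₂ + c₂ log t` for the non-ordinates
  `t > t₀ ≥ 1`, `U(t) = ∫_{1/2}^∞ log|ζ(σ+it)| dσ`, give
  `|∫_{t₁}^{t₂} S| ≤ (a₁+a₂)/π + (b₁/π) log log t₂ + ((c₁+c₂)/π) log t₂` for all `t₀ < t₁ ≤ t₂`
  (the `log log` variant of `Literature.NumberTheory.LFunctions.abs_integral_zetaArgS_le_of_bounds`).
* `log_le_rpow_div_exp_mul`, `log_rpow_le_mul_rpow` — `log x ≤ x^ε/(eε)`,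
  `(log x)^k ≤ (eε)^{−k} x^{εk}` (`x ≥ 1`).
* `norm_riemannZeta₁_le_interpolate` — Rademacher's theorem for the entire `ζ₁(s) = (s−1)ζ(s)` on
  any strip `a ≤ σ ≤ b`, `a ≥ ½` (the growth hypothesis discharged once and for all).
* `norm_riemannZeta₁_le_trudgianII_half_one`, `norm_riemannZeta₁_le_trudgianII_one_delta` —
  [Trudgian2016, Lemma 1, (4)–(5)] in a **sharp form**: from the edge bounds
  `|ζ₁(½+iu)| ≤ k₁|Q₀+½+iu|^{k₂+1}(log|Q₀+½+iu|)^{k₃}`, `|ζ₁(1+iu)| ≤ k₄|Q₀+1+iu|(log|Q₀+1+iu|)^{k₅}`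
  (all real `u`) one gets, with `N = |Q₀+s|`, `L = log N`,
  `|ζ₁(s)| ≤ k₁^{2(1−σ)} k₄^{2σ−1} N^{2k₂(1−σ)+1} L^{2k₃(1−σ)+k₅(2σ−1)}` on `½ ≤ σ ≤ 1` and
  `|ζ₁(s)| ≤ k₄^{(1+δ−σ)/δ} ζ(1+δ)^{(σ−1)/δ} N L^{k₅(1+δ−σ)/δ}` on `1 ≤ σ ≤ 1+δ`.
* `setIntegral_Ioi_half_log_norm_riemannZeta_le_trudgianII(')` — [Trudgian2016, Lemma 2]: for
  `t > 0` (resp. `t > t₀ > 1`) not an ordinate, `U(t) ≤ A₁ + B₁ log log t + C₁ log t` with the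
  printed `B₁ = (k₃+k₅)/4 + δk₅/2`, `C₁ = k₂/4` and an `A₁` *smaller* than the printed one.
* `abs_integral_zetaArgS_le_trudgianII_of_lower` — [Trudgian2016, Thm 2] modulo the lower bound:
  the edge bounds and any `−U(t) ≤ a₂ + c₂ log t` give `|∫ S| ≤ a + b log log t₂ + c log t₂` with
  `πb = (k₃+k₅)/4 + δk₅/2`, `πc = k₂/4 + c₂`.
* `abs_integral_zetaArgS_le_trudgianII_of` — **the named fact from its inputs**, for the row
  `T = 10¹⁰` of [Trudgian2016, Table 1] (`δ = 0.148`, `d = 0.762`, `(k₁,…,k₅,Q₀) = (0.732, 1/6, 1,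
  3/4, 1, 5)`): hypotheses `H1` (critical line), `H2` (line `σ = 1`), `hL` (the lower bound of
  [Trudgian2011, Lemma 2.11] at `d = 0.762`, `t > 10⁵`), and one numerical inequality `hnum`
  (`A₁ + a₂ ≤ 1.698π`, involving `∫_{1.148}^∞ log ζ(σ) dσ` and `ζ(1.148)`); the inequalities
  `0.574/π ≤ 0.183` and `(1/24 + (0.762²/2)(log 4 − 1))/π ≤ 0.049` are checked here.
* `norm_riemannZeta₁_half_line_le_of_shifted`, `norm_riemannZeta₁_one_line_le_of` — the edge
  hypotheses `H1`, `H2` from bounds in their published shapes: `|ζ(½+it)| ≤ k₁|Q+it|^{k₂}(log|Q+it|)^{k₃}`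
  for all real `t` ([PlattTrudgian2015, Cor. 2]), resp. `|ζ(1+it)| ≤ k₄ (log t)^{k₅}` for `t ≥ T`
  plus a bound for `|t| < T`.

## The log-power Phragmén–Lindelöf step (design note)

Trudgian proves Lemma 1 with his log-power extension of Rademacher's theorem ([Trudgian2014],
Lemma 3: edge bounds `A|Q+s|^{α₁}(log|Q+s|)^{α₂}`, conclusion with `|log(Q+s)|^{…}`), and then pays
a factor `(1+a₀)^{k₃+k₅}`, `a₀ ≈ π/(2 log t₀) ≈ 0.136` at `t₀ = 10⁵`, to return from `|log(Q₀+s)|`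
to `log t` (his (2)).  We do not formalise that lemma (its bisection proof does not iterate, since
`x ↦ |log(x+it)|` is not monotone).  Instead we feed Rademacher's theorem (proved in the tree) the
power bounds `(log N)^k ≤ (eε)^{−k} N^{εk}` and choose `ε = 1/log|Q₀+s|` *at each point*
afterwards: this yields the interpolation inequality with `log|Q₀+s|` itself — the bound one would
get from the superharmonicity of `γ(σ) log log|Q+s|` — and hence Lemma 2 with the printed
`B₁, C₁` and a slightly smaller `A₁` (no `log(1+a₀)`, and `log(1+a₁)` replaced by
`(Q₀+1+δ)²/(2t₀²)`).  The only extra hypothesis is `k₅ − k₃ ≤ k₂ log(Q₀+½)` (Rademacher's `α ≥ β`),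
vacuous for the paper's sub-convexity parameters `k₃ = k₅ = 1`.

## Status of the inputs (what is NOT here)

* `H1` is [PlattTrudgian2015, Cor. 2] (`|ζ(½+it)| < 0.732|Q+it|^{1/6} log|Q+it|`, `Q ≥ 4.678`, all
  real `t`) times `|s−1| ≤ |Q₀+s|`; `H2` is [TrudgianZetaOne2014] (`|ζ(1+it)| ≤ ¾ log t`, `t ≥ 3`)
  plus an elementary bound for `|t| < 3`.  Both published proofs rest on Lemma 3 of Cheng–Graham
  (2004), reported flawed by Patel (arXiv:2009.00769, §2); the *statements* needed here follow from
  the later Hiary–Patel–Yang bound `0.618 t^{1/6} log t` (`t ≥ 3`) and from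
  `|ζ(1+it)| ≤ ½ log t + 1.93` (`t ≥ 3`, Patel) / `0.6443 log t` (`t ≥ e`, arXiv:2412.00766)
  together with finite certified computations.  None of these is in the tree.
* `hL` is [Trudgian2011, Lemma 2.11]; its proof needs Booker's lemma, the tree's *named fact*
  `Literature.NumberTheory.LFunctions.Trudgian2011_lemma_2_10` (`BookerLemma.lean`, unproved), the
  Hadamard product of `ξ` (`RiemannXiHadamardProduct.lean`, proved) and explicit Stirling bounds.
* `hnum` and the constant `a₂` of `hL` are certified numerics (`∫ log ζ`, `ζ'(1.262)/ζ(1.262)`,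
  `ζ(1.148)`), cf. `LogZetaConvex.lean`, `ZetaCertifiedEvaluation.lean`.
With `(δ, d) = (0.148, 0.762)` one finds numerically `A₁ ≈ 1.337`, `a₂ ≈ 3.958`, so
`(A₁ + a₂)/π ≈ 1.685 < 1.698` (the printed `A₁`, with `log(1+a₀)`, gives `≈ 1.709`; the paper's
table evidently used the sharper `|log z| ≤ 1.007 log T` of [Trudgian2014, (4.2)]).

## References

* T. S. Trudgian, *Improvements to Turing's method II*, Rocky Mountain J. Math. 46 (2016),
  325–332, Lemmas 1–2, Thms 1–2, Table 1.  [Trudgian2016]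
* T. S. Trudgian, *Improvements to Turing's method*, Math. Comp. 80 (2011), 2259–2279, §2.2,
  Lemmas 2.4–2.12.  [Trudgian2011]
* T. S. Trudgian, *An improved upper bound for the argument of the Riemann zeta-function on the
  critical line II*, J. Number Theory 134 (2014), 280–292, Lemma 3.  [Trudgian2014]
* D. J. Platt, T. S. Trudgian, *An improved explicit bound on `|ζ(½+it)|`*, J. Number Theory 147
  (2015), 842–851, Thm 1, Cor. 2.  [PlattTrudgian2015]
* T. S. Trudgian, *A new upper bound for `|ζ(1+it)|`*, Bull. Aust. Math. Soc. 89 (2014), 259–264.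
  [TrudgianZetaOne2014]
* H. Rademacher, *On the Phragmén–Lindelöf theorem and some applications*, Math. Z. 72 (1959),
  Thm 2.  [Rademacher1959]
-/

noncomputable section

open Complex Set MeasureTheory Filter Topology intervalIntegral
open scoped Real

namespace Literature.NumberTheory.LFunctions

/-! ### Assembly with a `log log t` term (Trudgian 2016, Thm 2 glue) -/

/-- **Turing's method, assembly of the `∫ S` bound from bounds for `∫ log|ζ|` with a `log log`
term** ([Trudgian 2016, "We combine Lemma 2 with Lemma 2.11 in [Trudgian 2011] to obtain
Theorem 2"]): if for every `t > t₀ ≥ 1` that is not an ordinate of a zero,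
`U(t) := ∫_{1/2}^∞ log|ζ(σ+it)| dσ ≤ a₁ + b₁ log log t + c₁ log t` and `−U(t) ≤ a₂ + c₂ log t`
(`b₁, c₁, c₂ ≥ 0`), then for all non-ordinates `t₀ < t₁ ≤ t₂`,
`|∫_{t₁}^{t₂} S(t) dt| ≤ (a₁ + a₂)/π + (b₁/π) log log t₂ + ((c₁ + c₂)/π) log t₂`
(Turing's lemma `π ∫_{t₁}^{t₂} S = U(t₂) − U(t₁)`,
`Literature.NumberTheory.LFunctions.pi_mul_integral_zetaArgS_eq`). [cite: Trudgian2016, Thm 2 (proof)] -/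
theorem abs_integral_zetaArgS_le_of_bounds_loglog_of_not_ordinate {a₁ b₁ c₁ a₂ c₂ t₀ : ℝ}
    (ht₀ : 1 ≤ t₀) (hb₁ : 0 ≤ b₁) (hc₁ : 0 ≤ c₁) (hc₂ : 0 ≤ c₂)
    (hU : ∀ t : ℝ, t₀ < t → (∀ ρ : ℂ, riemannZeta ρ = 0 → ρ.im ≠ t) →
      ∫ x in Ioi (1 / 2 : ℝ), Real.log ‖riemannZeta (x + t * I)‖ ≤
        a₁ + b₁ * Real.log (Real.log t) + c₁ * Real.log t)
    (hL : ∀ t : ℝ, t₀ < t → (∀ ρ : ℂ, riemannZeta ρ = 0 → ρ.im ≠ t) →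
      -(∫ x in Ioi (1 / 2 : ℝ), Real.log ‖riemannZeta (x + t * I)‖) ≤ a₂ + c₂ * Real.log t)
    {t₁ t₂ : ℝ} (h₁ : t₀ < t₁) (h12 : t₁ ≤ t₂)
    (h1' : ∀ ρ : ℂ, riemannZeta ρ = 0 → ρ.im ≠ t₁) (h2' : ∀ ρ : ℂ, riemannZeta ρ = 0 → ρ.im ≠ t₂) :
    |∫ t in t₁..t₂, zetaArgS t| ≤
      (a₁ + a₂) / π + b₁ / π * Real.log (Real.log t₂) + (c₁ + c₂) / π * Real.log t₂ := by
  have hπ := Real.pi_pos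
  have ht₁ : 0 < t₁ := by linarith
  have hT := pi_mul_integral_zetaArgS_eq ht₁ h12 h1' h2'
  set U₁ := ∫ x in Ioi (1 / 2 : ℝ), Real.log ‖riemannZeta (x + t₁ * I)‖
  set U₂ := ∫ x in Ioi (1 / 2 : ℝ), Real.log ‖riemannZeta (x + t₂ * I)‖
  have hU1 := hU t₁ h₁ h1'
  have hU2 := hU t₂ (h₁.trans_le h12) h2'
  have hL1 := hL t₁ h₁ h1'
  have hL2 := hL t₂ (h₁.trans_le h12) h2'
  have hlog1 : 0 < Real.log t₁ := Real.log_pos (by linarith)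
  have hlog : Real.log t₁ ≤ Real.log t₂ := Real.log_le_log ht₁ h12
  have hlog0 : 0 ≤ Real.log t₁ := hlog1.le
  have hll : Real.log (Real.log t₁) ≤ Real.log (Real.log t₂) := Real.log_le_log hlog1 hlog
  have key : π * |∫ t in t₁..t₂, zetaArgS t| ≤
      (a₁ + a₂) + b₁ * Real.log (Real.log t₂) + (c₁ + c₂) * Real.log t₂ := by
    rw [← abs_of_pos hπ, ← abs_mul, hT, abs_le]
    constructor <;> nlinarith
  rw [show (a₁ + a₂) / π + b₁ / π * Real.log (Real.log t₂) + (c₁ + c₂) / π * Real.log t₂ =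
      ((a₁ + a₂) + b₁ * Real.log (Real.log t₂) + (c₁ + c₂) * Real.log t₂) / π by ring,
    le_div_iff₀ hπ]
  linarith

/-- The same for **all** `t₀ < t₁ ≤ t₂` (ordinates included), by the density of non-ordinates and
the continuity of `u ↦ ∫ S` (as in `Literature.NumberTheory.LFunctions.abs_integral_zetaArgS_le_of_bounds`).
This is the shape of [Trudgian 2016, Thm 2]: `|∫_{t₁}^{t₂} S(t) dt| ≤ a + b log log t₂ + c log t₂`
with `a = (a₁+a₂)/π`, `b = b₁/π`, `c = (c₁+c₂)/π`. [cite: Trudgian2016, Thm 2 (proof)] -/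
theorem abs_integral_zetaArgS_le_of_bounds_loglog {a₁ b₁ c₁ a₂ c₂ t₀ : ℝ}
    (ht₀ : 1 ≤ t₀) (hb₁ : 0 ≤ b₁) (hc₁ : 0 ≤ c₁) (hc₂ : 0 ≤ c₂)
    (hU : ∀ t : ℝ, t₀ < t → (∀ ρ : ℂ, riemannZeta ρ = 0 → ρ.im ≠ t) →
      ∫ x in Ioi (1 / 2 : ℝ), Real.log ‖riemannZeta (x + t * I)‖ ≤
        a₁ + b₁ * Real.log (Real.log t) + c₁ * Real.log t)
    (hL : ∀ t : ℝ, t₀ < t → (∀ ρ : ℂ, riemannZeta ρ = 0 → ρ.im ≠ t) →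
      -(∫ x in Ioi (1 / 2 : ℝ), Real.log ‖riemannZeta (x + t * I)‖) ≤ a₂ + c₂ * Real.log t)
    {t₁ t₂ : ℝ} (h₁ : t₀ < t₁) (h12 : t₁ ≤ t₂) :
    |∫ t in t₁..t₂, zetaArgS t| ≤
      (a₁ + a₂) / π + b₁ / π * Real.log (Real.log t₂) + (c₁ + c₂) / π * Real.log t₂ := by
  set a : ℝ := (a₁ + a₂) / π
  set b : ℝ := b₁ / π
  set c : ℝ := (c₁ + c₂) / π
  have hbase : ∀ u₁ u₂ : ℝ, t₀ < u₁ → u₁ ≤ u₂ → (∀ ρ : ℂ, riemannZeta ρ = 0 → ρ.im ≠ u₁) →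
      (∀ ρ : ℂ, riemannZeta ρ = 0 → ρ.im ≠ u₂) →
      |∫ t in u₁..u₂, zetaArgS t| ≤ a + b * Real.log (Real.log u₂) + c * Real.log u₂ :=
    fun u₁ u₂ hu₁ hu hn₁ hn₂ ↦
      abs_integral_zetaArgS_le_of_bounds_loglog_of_not_ordinate ht₀ hb₁ hc₁ hc₂ hU hL hu₁ hu hn₁ hn₂
  -- interval integrability of `S` and continuity of its primitives
  have hθc : Continuous riemannSiegelTheta :=
    continuous_iff_continuousAt.2 fun t ↦ (hasDerivAt_riemannSiegelTheta_holds t).continuousAt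
  have hS : ∀ a b : ℝ, IntervalIntegrable zetaArgS volume a b := by
    intro a b
    have hN : IntervalIntegrable (fun T : ℝ ↦ (zetaZeroCount T : ℝ)) volume a b :=
      Monotone.intervalIntegrable fun x y hxy ↦ Nat.cast_le.2 (zetaZeroCount_mono hxy)
    have h := (hN.sub ((hθc.div_const π).intervalIntegrable a b)).sub
      (intervalIntegrable_const (c := (1 : ℝ)))
    have e : zetaArgS = fun T ↦ (zetaZeroCount T : ℝ) - riemannSiegelTheta T / π - 1 := by
      funext T; rfl
    rw [e]; exact h
  have hprim : ∀ a : ℝ, Continuous fun b ↦ ∫ t in a..b, zetaArgS t := fun a ↦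
    intervalIntegral.continuous_primitive hS a
  -- non-ordinates are dense
  have hdense : ∀ a b : ℝ, a < b → 0 ≤ a →
      ∃ t ∈ Ioo a b, ∀ ρ : ℂ, riemannZeta ρ = 0 → ρ.im ≠ t := by
    intro a b hab ha
    set Ords : Set ℝ := Complex.im '' zetaZeroBox 0 b with hO
    have hfin : Ords.Finite := (zetaZeroBox_finite 0 b).image _
    obtain ⟨t, ht⟩ := ((Ioo_infinite hab).sdiff hfin).nonempty
    refine ⟨t, ht.1, fun ρ hρ him ↦ ht.2 ?_⟩
    have ht0 : 0 < t := ha.trans_lt ht.1.1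
    have hst := re_mem_Ioo_of_riemannZeta_eq_zero_of_im_ne_zero hρ (by rw [him]; exact ht0.ne')
    exact ⟨ρ, ⟨hρ, hst.1.le, hst.2.le, by rw [him]; exact ht0, by rw [him]; exact ht.1.2.le⟩, him⟩
  have ht₁0 : 0 ≤ t₁ := by linarith
  -- sequences `u₁ₙ ↓ t₁` (with `u₁ₙ ≤ u₂ₙ`) and `u₂ₙ ↓ t₂` of non-ordinates
  choose u₂ hu₂ hu₂' using fun n : ℕ ↦ hdense t₂ (t₂ + 1 / ((n : ℝ) + 1)) (by
    have : (0 : ℝ) < 1 / ((n : ℝ) + 1) := by positivity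
    linarith) (by linarith)
  have hpos : ∀ n : ℕ, t₁ < min (t₁ + 1 / ((n : ℝ) + 1)) (u₂ n) := fun n ↦
    lt_min (by have : (0 : ℝ) < 1 / ((n : ℝ) + 1) := by positivity
               linarith) (lt_of_le_of_lt h12 (hu₂ n).1)
  choose u₁ hu₁ hu₁' using fun n : ℕ ↦ hdense t₁ (min (t₁ + 1 / ((n : ℝ) + 1)) (u₂ n)) (hpos n) ht₁0
  have hlim1 : Tendsto u₁ atTop (𝓝 t₁) := by
    have h0 : Tendsto (fun n : ℕ ↦ t₁ + 1 / ((n : ℝ) + 1)) atTop (𝓝 (t₁ + 0)) :=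
      tendsto_const_nhds.add tendsto_one_div_add_atTop_nhds_zero_nat
    rw [add_zero] at h0
    refine tendsto_of_tendsto_of_tendsto_of_le_of_le tendsto_const_nhds h0 (fun n ↦ (hu₁ n).1.le)
      fun n ↦ (hu₁ n).2.le.trans (min_le_left _ _)
  have hlim2 : Tendsto u₂ atTop (𝓝 t₂) := by
    have h0 : Tendsto (fun n : ℕ ↦ t₂ + 1 / ((n : ℝ) + 1)) atTop (𝓝 (t₂ + 0)) :=
      tendsto_const_nhds.add tendsto_one_div_add_atTop_nhds_zero_nat
    rw [add_zero] at h0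
    exact tendsto_of_tendsto_of_tendsto_of_le_of_le tendsto_const_nhds h0 (fun n ↦ (hu₂ n).1.le)
      fun n ↦ (hu₂ n).2.le
  have hbound : ∀ n, |∫ t in u₁ n..u₂ n, zetaArgS t| ≤
      a + b * Real.log (Real.log (u₂ n)) + c * Real.log (u₂ n) := fun n ↦
    hbase (u₁ n) (u₂ n) (h₁.trans (hu₁ n).1) ((hu₁ n).2.le.trans (min_le_right _ _)) (hu₁' n) (hu₂' n)
  have hLim : Tendsto (fun n ↦ |∫ t in u₁ n..u₂ n, zetaArgS t|) atTop
      (𝓝 |∫ t in t₁..t₂, zetaArgS t|) := by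
    have e : ∀ n, ∫ t in u₁ n..u₂ n, zetaArgS t =
        (∫ t in t₁..u₂ n, zetaArgS t) - ∫ t in t₁..u₁ n, zetaArgS t := fun n ↦ by
      rw [← intervalIntegral.integral_add_adjacent_intervals (hS t₁ (u₁ n)) (hS (u₁ n) (u₂ n))]
      ring
    simp_rw [e]
    have h1 := (hprim t₁).continuousAt.tendsto.comp hlim1
    have h2 := (hprim t₁).continuousAt.tendsto.comp hlim2
    simp only [Function.comp_def, intervalIntegral.integral_same] at h1 h2
    have := (h2.sub h1).abs
    simpa using this
  have ht₂ : 1 < t₂ := by linarith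
  have hR : Tendsto (fun n ↦ a + b * Real.log (Real.log (u₂ n)) + c * Real.log (u₂ n)) atTop
      (𝓝 (a + b * Real.log (Real.log t₂) + c * Real.log t₂)) := by
    have hlogc : ContinuousAt Real.log t₂ := Real.continuousAt_log (by linarith)
    have hll : ContinuousAt (fun x : ℝ ↦ Real.log (Real.log x)) t₂ :=
      ContinuousAt.comp (g := Real.log) (Real.continuousAt_log (Real.log_pos ht₂).ne') hlogc
    have hc' : ContinuousAt (fun x : ℝ ↦ a + b * Real.log (Real.log x) + c * Real.log x) t₂ :=
      (continuousAt_const.add (hll.const_mul b)).add (hlogc.const_mul c)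
    exact hc'.tendsto.comp hlim2
  exact le_of_tendsto_of_tendsto' hLim hR hbound

end Literature.NumberTheory.LFunctions

open Complex Real Set

namespace Literature.NumberTheory.LFunctions


/-! ### Logarithms against small powers: `log x ≤ x^ε/(eε)` -/

/-- `log x ≤ x^ε / (e ε)` for `x > 0`, `ε > 0` (maximise `log y − y/e`). [folklore] -/
theorem log_le_rpow_div_exp_mul {x ε : ℝ} (hx : 0 < x) (hε : 0 < ε) :
    Real.log x ≤ x ^ ε / (Real.exp 1 * ε) := by
  have hy : 0 < x ^ ε / Real.exp 1 := by positivity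
  have h := Real.log_le_sub_one_of_pos hy
  rw [Real.log_div (Real.rpow_pos_of_pos hx ε).ne' (Real.exp_pos 1).ne', Real.log_exp,
    Real.log_rpow hx] at h
  rw [le_div_iff₀ (by positivity)]
  have : ε * Real.log x ≤ x ^ ε / Real.exp 1 := by linarith
  calc Real.log x * (Real.exp 1 * ε) = (ε * Real.log x) * Real.exp 1 := by ring
    _ ≤ x ^ ε / Real.exp 1 * Real.exp 1 := by gcongr
    _ = x ^ ε := by field_simp

/-- `(log x)^k ≤ (eε)^{−k} x^{εk}` for `x ≥ 1`, `ε > 0`, `k ≥ 0` (real exponent `k`). [folklore] -/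
theorem log_rpow_le_mul_rpow {x ε k : ℝ} (hx : 1 ≤ x) (hε : 0 < ε) (hk : 0 ≤ k) :
    Real.log x ^ k ≤ (Real.exp 1 * ε) ^ (-k) * x ^ (ε * k) := by
  have hx0 : 0 < x := by linarith
  have hlog : 0 ≤ Real.log x := Real.log_nonneg hx
  have h1 := log_le_rpow_div_exp_mul hx0 hε
  have heε : 0 < Real.exp 1 * ε := by positivity
  calc Real.log x ^ k ≤ (x ^ ε / (Real.exp 1 * ε)) ^ k := Real.rpow_le_rpow hlog h1 hk
    _ = (x ^ ε) ^ k * (Real.exp 1 * ε)⁻¹ ^ k := by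
        rw [div_eq_mul_inv, Real.mul_rpow (Real.rpow_nonneg hx0.le _) (inv_nonneg.2 heε.le)]
    _ = (Real.exp 1 * ε) ^ (-k) * x ^ (ε * k) := by
        rw [Real.rpow_mul hx0.le, Real.inv_rpow heε.le, ← Real.rpow_neg_one, ← Real.rpow_mul heε.le]
        ring_nf

/-! ### Rademacher's theorem for `ζ₁ = (s−1)ζ(s)` on a general strip `a ≤ σ ≤ b`, `a ≥ ½` -/

/-- **Rademacher's theorem for `ζ₁ = (s−1)ζ(s)` on a strip `a ≤ σ ≤ b` with `a ≥ ½`**: if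
`‖ζ₁‖ ≤ A‖Q+s‖^α` on `σ = a` and `‖ζ₁‖ ≤ B‖Q+s‖^β` on `σ = b` (`A, B > 0`, `β ≤ α`, `Q + a > 0`),
then for `a ≤ σ ≤ b`,
`‖ζ₁(s)‖ ≤ exp(log A · (b−σ)/(b−a) + log B · (σ−a)/(b−a)) · ‖Q+s‖^{α(b−σ)/(b−a) + β(σ−a)/(b−a)}`
(`Literature.Analysis.Complex.Rademacher.norm_le_exp_mul_rpow`; the growth hypothesis holds by
`norm_riemannZeta₁_le_exp`). [cite: Rademacher1959, Thm 2] -/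
theorem norm_riemannZeta₁_le_interpolate {a b Q A B α β : ℝ} (ha : 1 / 2 ≤ a) (hab : a < b)
    (hQ : 0 < Q + a) (hA : 0 < A) (hB : 0 < B) (hβα : β ≤ α)
    (hea : ∀ z : ℂ, z.re = a → ‖riemannZeta₁ z‖ ≤ A * ‖(Q : ℂ) + z‖ ^ α)
    (heb : ∀ z : ℂ, z.re = b → ‖riemannZeta₁ z‖ ≤ B * ‖(Q : ℂ) + z‖ ^ β)
    {z : ℂ} (hza : a ≤ z.re) (hzb : z.re ≤ b) :
    ‖riemannZeta₁ z‖ ≤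
      Real.exp (Real.log A * ((b - z.re) / (b - a)) + Real.log B * ((z.re - a) / (b - a))) *
        ‖(Q : ℂ) + z‖ ^ (α * ((b - z.re) / (b - a)) + β * ((z.re - a) / (b - a))) := by
  -- growth, from `norm_riemannZeta₁_le_exp` on `½ ≤ Re z ≤ b + 1`
  set c : ℝ := b + 1 with hcdef
  have hc : 1 < c := by rw [hcdef]; linarith
  set c₀ : ℝ := π / (b - a) / 2 with hc₀
  have hba : 0 < b - a := by linarith
  have hc₀lt : c₀ < π / (b - a) := by
    have : 0 < π / (b - a) := div_pos Real.pi_pos hba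
    rw [hc₀]; linarith
  have hc₀0 : 0 < c₀ := by rw [hc₀]; positivity
  have hgr : ∃ c' < π / (b - a), ∃ K' L : ℝ, ∀ z : ℂ, a < z.re → z.re < b →
      ‖riemannZeta₁ z‖ ≤ K' * Real.exp (L * Real.exp (c' * |z.im|)) := by
    refine ⟨c₀, hc₀lt, 3 * Real.exp (2 * c + 2), 2 / c₀, fun z hz1 hz2 ↦ ?_⟩
    refine (norm_riemannZeta₁_le_exp hc (by linarith) (by rw [hcdef]; linarith)).trans ?_
    refine mul_le_mul_of_nonneg_left (Real.exp_le_exp.2 ?_) (by positivity)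
    have := Real.add_one_le_exp (c₀ * |z.im|)
    calc 2 * |z.im| = 2 / c₀ * (c₀ * |z.im|) := by field_simp
      _ ≤ 2 / c₀ * Real.exp (c₀ * |z.im|) := by gcongr; linarith
  exact Literature.Analysis.Complex.Rademacher.norm_le_exp_mul_rpow (f := riemannZeta₁) hab hQ hA hB
    hβα differentiable_riemannZeta₁.diffContOnCl hgr hea heb hza hzb


/-- `‖Q₀ + z‖ ≥ Q₀ + Re z` and hence `> 1` when `Q₀ + Re z > 1`. [folklore] -/
theorem one_lt_norm_add_of_lt {Q₀ : ℝ} {z : ℂ} (h : 1 < Q₀ + z.re) : 1 < ‖(Q₀ : ℂ) + z‖ := by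
  refine lt_of_lt_of_le h (le_trans ?_ (abs_re_le_norm _))
  simp only [add_re, ofReal_re]
  exact le_abs_self _

/-- **Trudgian 2016, Lemma 1, eq. (4) — the strip `½ ≤ σ ≤ 1`, sharp form.**  Suppose that for
all real `u` (with `ζ₁(s) = (s−1)ζ(s)`, `Q₀ > ½`, `k₁, k₄ > 0`, `k₂, k₃, k₅ ≥ 0`)
`|ζ₁(½+iu)| ≤ k₁ |Q₀+½+iu|^{k₂+1} (log|Q₀+½+iu|)^{k₃}` and
`|ζ₁(1+iu)| ≤ k₄ |Q₀+1+iu| (log|Q₀+1+iu|)^{k₅}`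
(the first two displayed hypotheses of [Trudgian 2016, Lemma 1]).  Then for `½ ≤ σ ≤ 1`, with
`N = |Q₀+s|`, `L = log N` and provided `k₅ − k₃ ≤ k₂ L`,
`|ζ₁(s)| ≤ k₁^{2(1−σ)} k₄^{2σ−1} N^{2k₂(1−σ)+1} L^{2k₃(1−σ) + k₅(2σ−1)}`.
This is the conclusion of Trudgian's log-power Phragmén–Lindelöf lemma ([Trudgian 2014b, Lemma 3])
with `log|Q₀+s|` in place of `|log(Q₀+s)|` (so no factor `(1+a₀)` is lost later); it is obtained
from Rademacher's theorem (`norm_riemannZeta₁_le_interpolate`) applied with the edge bounds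
`(log N)^k ≤ (eε)^{−k} N^{εk}` (`log_rpow_le_mul_rpow`) and the choice `ε = 1/L`.
[cite: Trudgian2016, Lemma 1] -/
theorem norm_riemannZeta₁_le_trudgianII_half_one {k₁ k₂ k₃ k₄ k₅ Q₀ : ℝ} (hk₁ : 0 < k₁)
    (hk₃ : 0 ≤ k₃) (hk₄ : 0 < k₄) (hk₅ : 0 ≤ k₅) (hQ₀ : 1 / 2 < Q₀)
    (H1 : ∀ u : ℝ, ‖riemannZeta₁ (1 / 2 + u * I)‖ ≤
      k₁ * ‖(Q₀ : ℂ) + (1 / 2 + u * I)‖ ^ (k₂ + 1) * Real.log ‖(Q₀ : ℂ) + (1 / 2 + u * I)‖ ^ k₃)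
    (H2 : ∀ u : ℝ, ‖riemannZeta₁ (1 + u * I)‖ ≤
      k₄ * ‖(Q₀ : ℂ) + (1 + u * I)‖ * Real.log ‖(Q₀ : ℂ) + (1 + u * I)‖ ^ k₅)
    {s : ℂ} (h1 : 1 / 2 ≤ s.re) (h2 : s.re ≤ 1)
    (hk : k₅ - k₃ ≤ k₂ * Real.log ‖(Q₀ : ℂ) + s‖) :
    ‖riemannZeta₁ s‖ ≤ k₁ ^ (2 * (1 - s.re)) * k₄ ^ (2 * s.re - 1) *
      ‖(Q₀ : ℂ) + s‖ ^ (2 * k₂ * (1 - s.re) + 1) *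
      Real.log ‖(Q₀ : ℂ) + s‖ ^ (2 * k₃ * (1 - s.re) + k₅ * (2 * s.re - 1)) := by
  set N : ℝ := ‖(Q₀ : ℂ) + s‖ with hN
  have hN1 : 1 < N := one_lt_norm_add_of_lt (by linarith)
  have hN0 : 0 < N := by linarith
  set L : ℝ := Real.log N with hL
  have hL0 : 0 < L := Real.log_pos hN1
  set ε : ℝ := L⁻¹ with hε
  have hε0 : 0 < ε := inv_pos.2 hL0
  have hεL : ε * L = 1 := inv_mul_cancel₀ hL0.ne'
  have he : 0 < Real.exp 1 * ε := by positivity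
  -- the Rademacher data
  set A : ℝ := k₁ * (Real.exp 1 * ε) ^ (-k₃) with hA
  set B : ℝ := k₄ * (Real.exp 1 * ε) ^ (-k₅) with hB
  set α : ℝ := k₂ + 1 + ε * k₃ with hα
  set β : ℝ := 1 + ε * k₅ with hβ
  have hA0 : 0 < A := by positivity
  have hB0 : 0 < B := by positivity
  have hβα : β ≤ α := by
    rw [hα, hβ]
    have : ε * (k₅ - k₃) ≤ k₂ := by
      have h := mul_le_mul_of_nonneg_left hk hε0.le
      rwa [← mul_assoc, mul_comm ε k₂, mul_assoc, hεL, mul_one] at h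
    nlinarith
  -- edges
  have hedge : ∀ (z : ℂ) (k K e : ℝ), 0 < K → 0 ≤ k → 1 ≤ ‖(Q₀ : ℂ) + z‖ →
      ‖riemannZeta₁ z‖ ≤ K * ‖(Q₀ : ℂ) + z‖ ^ e * Real.log ‖(Q₀ : ℂ) + z‖ ^ k →
      ‖riemannZeta₁ z‖ ≤ K * (Real.exp 1 * ε) ^ (-k) * ‖(Q₀ : ℂ) + z‖ ^ (e + ε * k) := by
    intro z k K e hK hk0 hz h
    have hz0 : 0 < ‖(Q₀ : ℂ) + z‖ := by linarith
    have hl := log_rpow_le_mul_rpow hz hε0 hk0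
    calc ‖riemannZeta₁ z‖ ≤ K * ‖(Q₀ : ℂ) + z‖ ^ e * Real.log ‖(Q₀ : ℂ) + z‖ ^ k := h
      _ ≤ K * ‖(Q₀ : ℂ) + z‖ ^ e * ((Real.exp 1 * ε) ^ (-k) * ‖(Q₀ : ℂ) + z‖ ^ (ε * k)) := by
          gcongr
      _ = K * (Real.exp 1 * ε) ^ (-k) * ‖(Q₀ : ℂ) + z‖ ^ (e + ε * k) := by
          rw [Real.rpow_add hz0]; ring
  have hea : ∀ z : ℂ, z.re = 1 / 2 → ‖riemannZeta₁ z‖ ≤ A * ‖(Q₀ : ℂ) + z‖ ^ α := by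
    intro z hz
    have e : z = 1 / 2 + z.im * I := by apply Complex.ext <;> simp [hz]
    have hz1 : 1 ≤ ‖(Q₀ : ℂ) + z‖ := (one_lt_norm_add_of_lt (by rw [hz]; linarith)).le
    have h := H1 z.im
    rw [← e] at h
    have := hedge z k₃ k₁ (k₂ + 1) hk₁ hk₃ hz1 h
    rw [hA, hα]; convert this using 2
  have heb : ∀ z : ℂ, z.re = 1 → ‖riemannZeta₁ z‖ ≤ B * ‖(Q₀ : ℂ) + z‖ ^ β := by
    intro z hz
    have e : z = 1 + z.im * I := by apply Complex.ext <;> simp [hz]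
    have hz1 : 1 ≤ ‖(Q₀ : ℂ) + z‖ := (one_lt_norm_add_of_lt (by rw [hz]; linarith)).le
    have h := H2 z.im
    rw [← e] at h
    have h' : ‖riemannZeta₁ z‖ ≤ k₄ * ‖(Q₀ : ℂ) + z‖ ^ (1 : ℝ) * Real.log ‖(Q₀ : ℂ) + z‖ ^ k₅ := by
      rwa [Real.rpow_one]
    have := hedge z k₅ k₄ 1 hk₄ hk₅ hz1 h'
    rw [hB, hβ]; convert this using 2
  -- Rademacher on `[½, 1]`
  have key := norm_riemannZeta₁_le_interpolate (a := 1 / 2) (b := 1) (Q := Q₀) le_rfl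
    (by norm_num) (by linarith) hA0 hB0 hβα hea heb h1 h2
  refine key.trans (le_of_eq ?_)
  -- identify the two sides (both are exponentials)
  have hlogA : Real.log A = Real.log k₁ - k₃ * (1 - Real.log L) := by
    rw [hA, Real.log_mul hk₁.ne' (Real.rpow_pos_of_pos he _).ne', Real.log_rpow he,
      Real.log_mul (Real.exp_pos 1).ne' hε0.ne', Real.log_exp, hε, Real.log_inv]; ring
  have hlogB : Real.log B = Real.log k₄ - k₅ * (1 - Real.log L) := by
    rw [hB, Real.log_mul hk₄.ne' (Real.rpow_pos_of_pos he _).ne', Real.log_rpow he,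
      Real.log_mul (Real.exp_pos 1).ne' hε0.ne', Real.log_exp, hε, Real.log_inv]; ring
  set p : ℝ := (1 - s.re) / (1 - 1 / 2) with hp
  set q : ℝ := (s.re - 1 / 2) / (1 - 1 / 2) with hq
  have hp' : p = 2 * (1 - s.re) := by rw [hp]; ring
  have hq' : q = 2 * s.re - 1 := by rw [hq]; ring
  rw [Real.rpow_def_of_pos hN0, Real.rpow_def_of_pos hk₁, Real.rpow_def_of_pos hk₄,
    Real.rpow_def_of_pos hN0, Real.rpow_def_of_pos hL0, ← Real.exp_add, ← Real.exp_add,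
    ← Real.exp_add, ← Real.exp_add]
  congr 1
  rw [hlogA, hlogB, ← hL, ← hp', ← hq', hα, hβ]
  have e1 : (k₂ + 1 + ε * k₃) * p + (1 + ε * k₅) * q =
      ((k₂ + 1) * p + q) + ε * (k₃ * p + k₅ * q) := by ring
  rw [e1, hp', hq', hε]
  field_simp
  ring


/-- **Trudgian 2016, Lemma 1, eq. (5) — the strip `1 ≤ σ ≤ 1+δ`, sharp form.**  Suppose that for
all real `u`, `|ζ₁(1+iu)| ≤ k₄ |Q₀+1+iu| (log|Q₀+1+iu|)^{k₅}` (`k₄ > 0`, `k₅ ≥ 0`, `Q₀ > 0`), and let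
`δ > 0`.  Then for `1 ≤ σ ≤ 1+δ`, with `N = |Q₀+s|`, `L = log N`,
`|ζ₁(s)| ≤ k₄^{(1+δ−σ)/δ} ζ(1+δ)^{(σ−1)/δ} N L^{k₅(1+δ−σ)/δ}`
(the third edge bound `|ζ₁(1+δ+iu)| ≤ ζ(1+δ)|Q₀+1+δ+iu|` of [Trudgian 2016, Lemma 1] holds
automatically: `|ζ(s)| ≤ ζ(σ)`, `|s−1| ≤ |Q₀+s|`).  As for `norm_riemannZeta₁_le_trudgianII_half_one`,
this is Rademacher's theorem with `(log N)^k ≤ (eε)^{−k}N^{εk}` on the edge and `ε = 1/L`; the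
factor `α₂ = (1+a₁)(1+a₀)^{k₅}` of the printed (5) is not lost. [cite: Trudgian2016, Lemma 1] -/
theorem norm_riemannZeta₁_le_trudgianII_one_delta {k₄ k₅ Q₀ δ : ℝ} (hk₄ : 0 < k₄) (hk₅ : 0 ≤ k₅)
    (hQ₀ : 0 < Q₀) (hδ : 0 < δ)
    (H2 : ∀ u : ℝ, ‖riemannZeta₁ (1 + u * I)‖ ≤
      k₄ * ‖(Q₀ : ℂ) + (1 + u * I)‖ * Real.log ‖(Q₀ : ℂ) + (1 + u * I)‖ ^ k₅)
    {s : ℂ} (h1 : 1 ≤ s.re) (h2 : s.re ≤ 1 + δ) :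
    ‖riemannZeta₁ s‖ ≤ k₄ ^ ((1 + δ - s.re) / δ) * (riemannZeta ((1 + δ : ℝ) : ℂ)).re ^ ((s.re - 1) / δ) *
      ‖(Q₀ : ℂ) + s‖ * Real.log ‖(Q₀ : ℂ) + s‖ ^ (k₅ * ((1 + δ - s.re) / δ)) := by
  set N : ℝ := ‖(Q₀ : ℂ) + s‖ with hN
  have hN1 : 1 < N := one_lt_norm_add_of_lt (by linarith)
  have hN0 : 0 < N := by linarith
  set L : ℝ := Real.log N with hL
  have hL0 : 0 < L := Real.log_pos hN1
  set ε : ℝ := L⁻¹ with hε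
  have hε0 : 0 < ε := inv_pos.2 hL0
  have he : 0 < Real.exp 1 * ε := by positivity
  have hc : 1 < 1 + δ := by linarith
  set Bc : ℝ := (riemannZeta ((1 + δ : ℝ) : ℂ)).re with hBc
  have hBc0 : 0 < Bc := riemannZeta_re_pos_of_one_lt hc
  -- the Rademacher data
  set A : ℝ := k₄ * (Real.exp 1 * ε) ^ (-k₅) with hA
  set α : ℝ := 1 + ε * k₅ with hα
  have hA0 : 0 < A := by positivity
  have hβα : (1 : ℝ) ≤ α := by rw [hα]; nlinarith [hε0.le, hk₅]
  have hea : ∀ z : ℂ, z.re = 1 → ‖riemannZeta₁ z‖ ≤ A * ‖(Q₀ : ℂ) + z‖ ^ α := by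
    intro z hz
    have e : z = 1 + z.im * I := by apply Complex.ext <;> simp [hz]
    have hz1 : 1 ≤ ‖(Q₀ : ℂ) + z‖ := (one_lt_norm_add_of_lt (by rw [hz]; linarith)).le
    have hz0 : 0 < ‖(Q₀ : ℂ) + z‖ := by linarith
    have h := H2 z.im
    rw [← e] at h
    have hl := log_rpow_le_mul_rpow hz1 hε0 hk₅
    rw [hA, hα]
    calc ‖riemannZeta₁ z‖ ≤ k₄ * ‖(Q₀ : ℂ) + z‖ * Real.log ‖(Q₀ : ℂ) + z‖ ^ k₅ := h
      _ ≤ k₄ * ‖(Q₀ : ℂ) + z‖ * ((Real.exp 1 * ε) ^ (-k₅) * ‖(Q₀ : ℂ) + z‖ ^ (ε * k₅)) := by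
          gcongr
      _ = k₄ * (Real.exp 1 * ε) ^ (-k₅) * ‖(Q₀ : ℂ) + z‖ ^ (1 + ε * k₅) := by
          rw [Real.rpow_add hz0, Real.rpow_one]; ring
  have heb : ∀ z : ℂ, z.re = 1 + δ → ‖riemannZeta₁ z‖ ≤ Bc * ‖(Q₀ : ℂ) + z‖ ^ (1 : ℝ) := by
    intro z hz
    have hz1 : z ≠ 1 := fun h ↦ by rw [h, Complex.one_re] at hz; linarith
    have hζ : ‖riemannZeta z‖ ≤ Bc := by
      have := norm_riemannZeta_le_re_riemannZeta (s := z) (by rw [hz]; exact hc)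
      rwa [hz] at this
    have hzm1 : ‖z - 1‖ ≤ ‖(Q₀ : ℂ) + z‖ := by
      have e : z = ((1 + δ : ℝ) : ℂ) + z.im * I := by apply Complex.ext <;> simp [hz]
      rw [e]
      have k1 : ((1 + δ : ℝ) : ℂ) + z.im * I - 1 = ((δ : ℝ) : ℂ) + z.im * I := by push_cast; ring
      have k2 : (Q₀ : ℂ) + (((1 + δ : ℝ) : ℂ) + z.im * I) = ((Q₀ + 1 + δ : ℝ) : ℂ) + z.im * I := by
        push_cast; ring
      rw [k1, k2, Complex.norm_add_mul_I, Complex.norm_add_mul_I]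
      exact Real.sqrt_le_sqrt (by nlinarith)
    rw [LFunctions.riemannZeta₁_eq_mul hz1, norm_mul, Real.rpow_one]
    calc ‖z - 1‖ * ‖riemannZeta z‖ ≤ ‖(Q₀ : ℂ) + z‖ * Bc :=
          mul_le_mul hzm1 hζ (norm_nonneg _) (norm_nonneg _)
      _ = Bc * ‖(Q₀ : ℂ) + z‖ := by ring
  -- Rademacher on `[1, 1+δ]`
  have key := norm_riemannZeta₁_le_interpolate (a := 1) (b := 1 + δ) (Q := Q₀) (by norm_num)
    (by linarith) (by linarith) hA0 hBc0 hβα hea heb h1 h2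
  refine key.trans (le_of_eq ?_)
  have hlogA : Real.log A = Real.log k₄ - k₅ * (1 - Real.log L) := by
    rw [hA, Real.log_mul hk₄.ne' (Real.rpow_pos_of_pos he _).ne', Real.log_rpow he,
      Real.log_mul (Real.exp_pos 1).ne' hε0.ne', Real.log_exp, hε, Real.log_inv]; ring
  have hδ0 : (1 + δ - 1 : ℝ) = δ := by ring
  rw [hδ0]
  rw [show k₄ ^ ((1 + δ - s.re) / δ) * Bc ^ ((s.re - 1) / δ) * N *
      L ^ (k₅ * ((1 + δ - s.re) / δ)) =
      k₄ ^ ((1 + δ - s.re) / δ) * Bc ^ ((s.re - 1) / δ) * N ^ (1 : ℝ) *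
      L ^ (k₅ * ((1 + δ - s.re) / δ)) by rw [Real.rpow_one]]
  rw [Real.rpow_def_of_pos hN0, Real.rpow_def_of_pos hk₄, Real.rpow_def_of_pos hBc0,
    Real.rpow_def_of_pos hN0, Real.rpow_def_of_pos hL0, ← Real.exp_add, ← Real.exp_add,
    ← Real.exp_add, ← Real.exp_add]
  congr 1
  rw [hlogA, ← hL, hα, hε]
  field_simp
  ring

/-! ### Trudgian 2016, Lemma 2 (upper bound for `∫_{1/2}^∞ log|ζ(σ+it)| dσ`), exact form -/

open MeasureTheory intervalIntegral in
/-- **Trudgian 2016, Lemma 2 — exact form.**  Under the first two edge hypotheses of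
[Trudgian 2016, Lemma 1] on `ζ₁ = (s−1)ζ(s)` (all real `u`; `k₁, k₄ > 0`, `k₂, k₃, k₅ ≥ 0`,
`Q₀ > ½`, and `k₅ − k₃ ≤ k₂ log(Q₀+½)`, vacuous for the paper's `k₃ = k₅ = 1`), for `δ > 0` and
`t > 0` not an ordinate of a zero, with `M = |Q₀ + 1 + δ + it|`:
`∫_{1/2}^∞ log|ζ(σ+it)| dσ ≤ ∫_{1+δ}^∞ log ζ(σ) dσ + ¼ log k₁ + (¼ + δ/2) log k₄ + (δ/2) log ζ(1+δ)`
`  + (k₂/4) log M + (½ + δ)(log M − log t) + ((k₃+k₅)/4 + k₅δ/2) log log M`.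
(Integrate the logarithms of `norm_riemannZeta₁_le_trudgianII_half_one` over `[½, 1]` and of
`norm_riemannZeta₁_le_trudgianII_one_delta` over `[1, 1+δ]`, using `|s−1| ≥ t`, `|Q₀+s| ≤ M`; the
tail `∫_{1+δ}^∞` is Trudgian's `∫ log|ζ(σ)|`, `setIntegral_Ioi_log_norm_riemannZeta_le`.)  Compared
with the printed Lemma 2 (`A₁ + B₁ log log t + C₁ log t`, `B₁ = (k₃+k₅)/4 + δk₅/2`, `C₁ = k₂/4`),
no factor `log(1+a₀)` appears; see `setIntegral_Ioi_half_log_norm_riemannZeta_le_trudgianII'` for the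
`log log t`/`log t` form. [cite: Trudgian2016, Lemma 2] -/
theorem setIntegral_Ioi_half_log_norm_riemannZeta_le_trudgianII {k₁ k₂ k₃ k₄ k₅ Q₀ δ t : ℝ}
    (hk₁ : 0 < k₁) (hk₂ : 0 ≤ k₂) (hk₃ : 0 ≤ k₃) (hk₄ : 0 < k₄) (hk₅ : 0 ≤ k₅)
    (hQ₀ : 1 / 2 < Q₀) (hδ : 0 < δ) (hk : k₅ - k₃ ≤ k₂ * Real.log (Q₀ + 1 / 2))
    (H1 : ∀ u : ℝ, ‖riemannZeta₁ (1 / 2 + u * I)‖ ≤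
      k₁ * ‖(Q₀ : ℂ) + (1 / 2 + u * I)‖ ^ (k₂ + 1) * Real.log ‖(Q₀ : ℂ) + (1 / 2 + u * I)‖ ^ k₃)
    (H2 : ∀ u : ℝ, ‖riemannZeta₁ (1 + u * I)‖ ≤
      k₄ * ‖(Q₀ : ℂ) + (1 + u * I)‖ * Real.log ‖(Q₀ : ℂ) + (1 + u * I)‖ ^ k₅)
    (ht : 0 < t) (hord : ∀ ρ : ℂ, riemannZeta ρ = 0 → ρ.im ≠ t) :
    ∫ σ in Ioi (1 / 2 : ℝ), Real.log ‖riemannZeta (σ + t * I)‖ ≤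
      (∫ σ in Ioi (1 + δ), Real.log ‖riemannZeta σ‖) + 1 / 4 * Real.log k₁ +
        (1 / 4 + δ / 2) * Real.log k₄ + δ / 2 * Real.log (riemannZeta ((1 + δ : ℝ) : ℂ)).re +
        k₂ / 4 * Real.log ‖((Q₀ + 1 + δ : ℝ) : ℂ) + t * I‖ +
        (1 / 2 + δ) * (Real.log ‖((Q₀ + 1 + δ : ℝ) : ℂ) + t * I‖ - Real.log t) +
        ((k₃ + k₅) / 4 + k₅ * δ / 2) * Real.log (Real.log ‖((Q₀ + 1 + δ : ℝ) : ℂ) + t * I‖) := by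
  set M : ℝ := ‖((Q₀ + 1 + δ : ℝ) : ℂ) + t * I‖ with hM
  set Bc : ℝ := (riemannZeta ((1 + δ : ℝ) : ℂ)).re with hBc
  have hc : 1 < 1 + δ := by linarith
  have hBc0 : 0 < Bc := riemannZeta_re_pos_of_one_lt hc
  have hMt : t ≤ M := by
    have := abs_im_le_norm (((Q₀ + 1 + δ : ℝ) : ℂ) + t * I)
    simp only [add_im, ofReal_im, mul_im, I_re, I_im, ofReal_re, mul_zero, mul_one, zero_add,
      add_zero] at this
    rw [abs_of_pos ht] at this
    simpa [hM] using this
  have hM0 : 0 < M := ht.trans_le hMt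
  -- facts at a point `s = σ + it`, `½ ≤ σ ≤ 1 + δ`
  have hpt : ∀ σ : ℝ, 1 / 2 ≤ σ → σ ≤ 1 + δ →
      ((σ : ℂ) + t * I).re = σ ∧ ((σ : ℂ) + t * I) ≠ 1 ∧ 0 < ‖riemannZeta₁ ((σ : ℂ) + t * I)‖ ∧
      Real.log ‖riemannZeta ((σ : ℂ) + t * I)‖ =
        Real.log ‖riemannZeta₁ ((σ : ℂ) + t * I)‖ - Real.log ‖((σ : ℂ) + t * I) - 1‖ ∧
      t ≤ ‖((σ : ℂ) + t * I) - 1‖ ∧ 1 < ‖(Q₀ : ℂ) + ((σ : ℂ) + t * I)‖ ∧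
      ‖(Q₀ : ℂ) + ((σ : ℂ) + t * I)‖ ≤ M ∧ Q₀ + σ ≤ ‖(Q₀ : ℂ) + ((σ : ℂ) + t * I)‖ := by
    intro σ hσ1 hσ2
    set s : ℂ := (σ : ℂ) + t * I with hs
    have hsre : s.re = σ := by simp [hs]
    have hsim : s.im = t := by simp [hs]
    have hs1 : s ≠ 1 := fun h ↦ by have := congrArg Complex.im h; simp [hsim] at this; linarith
    have hζ0 : riemannZeta s ≠ 0 := fun h ↦ hord s h hsim
    have hζ₁ : 0 < ‖riemannZeta₁ s‖ := by
      rw [LFunctions.riemannZeta₁_eq_mul hs1, norm_mul]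
      exact mul_pos (norm_pos_iff.2 (sub_ne_zero.2 hs1)) (norm_pos_iff.2 hζ0)
    have hs1t : t ≤ ‖s - 1‖ := by
      have := abs_im_le_norm (s - 1)
      simp only [sub_im, one_im, sub_zero, hsim, abs_of_pos ht] at this
      exact this
    have hlog : Real.log ‖riemannZeta s‖ = Real.log ‖riemannZeta₁ s‖ - Real.log ‖s - 1‖ := by
      rw [LFunctions.riemannZeta₁_eq_mul hs1, norm_mul,
        Real.log_mul (norm_pos_iff.2 (sub_ne_zero.2 hs1)).ne' (norm_pos_iff.2 hζ0).ne']
      ring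
    have hN1 : 1 < ‖(Q₀ : ℂ) + s‖ := one_lt_norm_add_of_lt (by rw [hsre]; linarith)
    have hNM : ‖(Q₀ : ℂ) + s‖ ≤ M := by
      have e1 : (Q₀ : ℂ) + s = ((Q₀ + σ : ℝ) : ℂ) + t * I := by simp [hs]; ring
      rw [e1, hM, Complex.norm_add_mul_I, Complex.norm_add_mul_I]
      exact Real.sqrt_le_sqrt (by nlinarith)
    have hNre : Q₀ + σ ≤ ‖(Q₀ : ℂ) + s‖ := by
      refine le_trans ?_ (abs_re_le_norm _)
      simp [hs]; exact le_abs_self _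
    exact ⟨hsre, hs1, hζ₁, hlog, hs1t, hN1, hNM, hNre⟩
  have hlogM0 : 0 < Real.log M := by
    obtain ⟨-, -, -, -, -, hN1, hNM, -⟩ := hpt 1 (by norm_num) (by linarith)
    exact Real.log_pos (hN1.trans_le hNM)
  -- Part A: the strip `[½, 1]`
  set BA : ℝ → ℝ := fun σ ↦ 2 * (1 - σ) * Real.log k₁ + (2 * σ - 1) * Real.log k₄ +
    (2 * k₂ * (1 - σ) + 1) * Real.log M - Real.log t +
    (2 * k₃ * (1 - σ) + k₅ * (2 * σ - 1)) * Real.log (Real.log M) with hBA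
  have hptA : ∀ σ ∈ Icc (1 / 2 : ℝ) 1, Real.log ‖riemannZeta (σ + t * I)‖ ≤ BA σ := by
    intro σ hσ
    obtain ⟨hsre, hs1, hζ₁, hlog, hs1t, hN1, hNM, hNre⟩ := hpt σ hσ.1 (hσ.2.trans hc.le)
    set s : ℂ := (σ : ℂ) + t * I with hs
    set N : ℝ := ‖(Q₀ : ℂ) + s‖ with hN
    have hN0 : 0 < N := by linarith
    have hL0 : 0 < Real.log N := Real.log_pos hN1
    have hLM : Real.log N ≤ Real.log M := Real.log_le_log hN0 hNM
    have hLLM : Real.log (Real.log N) ≤ Real.log (Real.log M) := Real.log_le_log hL0 hLM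
    have hkσ : k₅ - k₃ ≤ k₂ * Real.log ‖(Q₀ : ℂ) + s‖ := by
      refine hk.trans (mul_le_mul_of_nonneg_left (Real.log_le_log (by linarith) ?_) hk₂)
      exact le_trans (by linarith [hσ.1]) hNre
    have hb := norm_riemannZeta₁_le_trudgianII_half_one hk₁ hk₃ hk₄ hk₅ hQ₀ H1 H2
      (s := s) (by rw [hsre]; exact hσ.1) (by rw [hsre]; exact hσ.2) hkσ
    rw [hsre] at hb
    have hE1 : 0 ≤ 2 * k₂ * (1 - σ) + 1 := by nlinarith [hσ.2]
    have hE2 : 0 ≤ 2 * k₃ * (1 - σ) + k₅ * (2 * σ - 1) := by nlinarith [hσ.1, hσ.2]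
    have hR0 : 0 < k₁ ^ (2 * (1 - σ)) * k₄ ^ (2 * σ - 1) * N ^ (2 * k₂ * (1 - σ) + 1) *
        Real.log N ^ (2 * k₃ * (1 - σ) + k₅ * (2 * σ - 1)) := by positivity
    rw [hlog]
    calc Real.log ‖riemannZeta₁ s‖ - Real.log ‖s - 1‖
        ≤ Real.log (k₁ ^ (2 * (1 - σ)) * k₄ ^ (2 * σ - 1) * N ^ (2 * k₂ * (1 - σ) + 1) *
            Real.log N ^ (2 * k₃ * (1 - σ) + k₅ * (2 * σ - 1))) - Real.log t := by
          gcongr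
      _ = 2 * (1 - σ) * Real.log k₁ + (2 * σ - 1) * Real.log k₄ +
            (2 * k₂ * (1 - σ) + 1) * Real.log N +
            (2 * k₃ * (1 - σ) + k₅ * (2 * σ - 1)) * Real.log (Real.log N) - Real.log t := by
          have h1 : k₁ ^ (2 * (1 - σ)) ≠ 0 := by positivity
          have h2 : k₄ ^ (2 * σ - 1) ≠ 0 := by positivity
          have h3 : N ^ (2 * k₂ * (1 - σ) + 1) ≠ 0 := by positivity
          have h4 : Real.log N ^ (2 * k₃ * (1 - σ) + k₅ * (2 * σ - 1)) ≠ 0 := by positivity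
          rw [Real.log_mul (by positivity) h4, Real.log_mul (by positivity) h3,
            Real.log_mul h1 h2, Real.log_rpow hk₁, Real.log_rpow hk₄, Real.log_rpow hN0,
            Real.log_rpow hL0]
      _ ≤ BA σ := by
          simp only [hBA]
          have l1 : (2 * k₂ * (1 - σ) + 1) * Real.log N ≤ (2 * k₂ * (1 - σ) + 1) * Real.log M :=
            mul_le_mul_of_nonneg_left hLM hE1
          have l2 : (2 * k₃ * (1 - σ) + k₅ * (2 * σ - 1)) * Real.log (Real.log N) ≤
              (2 * k₃ * (1 - σ) + k₅ * (2 * σ - 1)) * Real.log (Real.log M) :=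
            mul_le_mul_of_nonneg_left hLLM hE2
          linarith
  -- Part B: the strip `[1, 1+δ]`
  set BB : ℝ → ℝ := fun σ ↦ (1 + δ - σ) / δ * Real.log k₄ + (σ - 1) / δ * Real.log Bc +
    (Real.log M - Real.log t) + k₅ * ((1 + δ - σ) / δ) * Real.log (Real.log M) with hBB
  have hptB : ∀ σ ∈ Icc (1 : ℝ) (1 + δ), Real.log ‖riemannZeta (σ + t * I)‖ ≤ BB σ := by
    intro σ hσ
    obtain ⟨hsre, hs1, hζ₁, hlog, hs1t, hN1, hNM, hNre⟩ := hpt σ (by linarith [hσ.1]) hσ.2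
    set s : ℂ := (σ : ℂ) + t * I with hs
    set N : ℝ := ‖(Q₀ : ℂ) + s‖ with hN
    have hN0 : 0 < N := by linarith
    have hL0 : 0 < Real.log N := Real.log_pos hN1
    have hLM : Real.log N ≤ Real.log M := Real.log_le_log hN0 hNM
    have hLLM : Real.log (Real.log N) ≤ Real.log (Real.log M) := Real.log_le_log hL0 hLM
    have hb := norm_riemannZeta₁_le_trudgianII_one_delta hk₄ hk₅ (by linarith) hδ H2
      (s := s) (by rw [hsre]; exact hσ.1) (by rw [hsre]; exact hσ.2)
    rw [hsre] at hb
    have hp0 : 0 ≤ (1 + δ - σ) / δ := div_nonneg (by linarith [hσ.2]) hδ.le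
    have hE2 : 0 ≤ k₅ * ((1 + δ - σ) / δ) := mul_nonneg hk₅ hp0
    have hR0 : 0 < k₄ ^ ((1 + δ - σ) / δ) * Bc ^ ((σ - 1) / δ) * N *
        Real.log N ^ (k₅ * ((1 + δ - σ) / δ)) := by positivity
    rw [hlog]
    calc Real.log ‖riemannZeta₁ s‖ - Real.log ‖s - 1‖
        ≤ Real.log (k₄ ^ ((1 + δ - σ) / δ) * Bc ^ ((σ - 1) / δ) * N *
            Real.log N ^ (k₅ * ((1 + δ - σ) / δ))) - Real.log t := by
          gcongr
      _ = (1 + δ - σ) / δ * Real.log k₄ + (σ - 1) / δ * Real.log Bc + Real.log N +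
            k₅ * ((1 + δ - σ) / δ) * Real.log (Real.log N) - Real.log t := by
          have h1 : k₄ ^ ((1 + δ - σ) / δ) ≠ 0 := by positivity
          have h2 : Bc ^ ((σ - 1) / δ) ≠ 0 := by positivity
          have h4 : Real.log N ^ (k₅ * ((1 + δ - σ) / δ)) ≠ 0 := by positivity
          rw [Real.log_mul (by positivity) h4, Real.log_mul (by positivity) hN0.ne',
            Real.log_mul h1 h2, Real.log_rpow hk₄, Real.log_rpow hBc0, Real.log_rpow hL0]
      _ ≤ BB σ := by
          simp only [hBB]
          have l2 : k₅ * ((1 + δ - σ) / δ) * Real.log (Real.log N) ≤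
              k₅ * ((1 + δ - σ) / δ) * Real.log (Real.log M) :=
            mul_le_mul_of_nonneg_left hLLM hE2
          linarith
  -- integrability and splitting
  have hI := integrableOn_log_norm_riemannZeta ht hord
  have hsplit : ∫ σ in Ioi (1 / 2 : ℝ), Real.log ‖riemannZeta (σ + t * I)‖ =
      (∫ σ in (1 / 2 : ℝ)..1, Real.log ‖riemannZeta (σ + t * I)‖) +
        ((∫ σ in (1 : ℝ)..(1 + δ), Real.log ‖riemannZeta (σ + t * I)‖) +
          ∫ σ in Ioi (1 + δ), Real.log ‖riemannZeta (σ + t * I)‖) := by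
    rw [← Ioc_union_Ioi_eq_Ioi (show (1 / 2 : ℝ) ≤ 1 by norm_num),
      setIntegral_union (Ioc_disjoint_Ioi le_rfl) measurableSet_Ioi
        (hI.mono_set Ioc_subset_Ioi_self) (hI.mono_set (Ioi_subset_Ioi (by norm_num))),
      intervalIntegral.integral_of_le (by norm_num : (1 / 2 : ℝ) ≤ 1)]
    congr 1
    rw [← Ioc_union_Ioi_eq_Ioi hc.le,
      setIntegral_union (Ioc_disjoint_Ioi le_rfl) measurableSet_Ioi
        (hI.mono_set (Ioc_subset_Ioi_self.trans (Ioi_subset_Ioi (by norm_num))))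
        (hI.mono_set (Ioi_subset_Ioi (by linarith))),
      intervalIntegral.integral_of_le hc.le]
  have hintA : IntervalIntegrable (fun σ ↦ Real.log ‖riemannZeta (σ + t * I)‖) volume (1 / 2) 1 := by
    refine (intervalIntegrable_iff_integrableOn_Ioc_of_le (by norm_num)).2 ?_
    exact hI.mono_set Ioc_subset_Ioi_self
  have hintB : IntervalIntegrable (fun σ ↦ Real.log ‖riemannZeta (σ + t * I)‖) volume 1 (1 + δ) := by
    refine (intervalIntegrable_iff_integrableOn_Ioc_of_le hc.le).2 ?_
    exact hI.mono_set (Ioc_subset_Ioi_self.trans (Ioi_subset_Ioi (by norm_num)))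
  have hBAint : IntervalIntegrable BA volume (1 / 2) 1 := by
    apply Continuous.intervalIntegrable; simp only [hBA]; fun_prop
  have hBBint : IntervalIntegrable BB volume 1 (1 + δ) := by
    apply Continuous.intervalIntegrable; simp only [hBB]; fun_prop
  have hmonoA := intervalIntegral.integral_mono_on (by norm_num) hintA hBAint hptA
  have hmonoB := intervalIntegral.integral_mono_on hc.le hintB hBBint hptB
  have htail := setIntegral_Ioi_log_norm_riemannZeta_le hc ht hord
  -- evaluate `∫ BA` and `∫ BB`
  have hvalA : ∫ σ in (1 / 2 : ℝ)..1, BA σ = 1 / 4 * Real.log k₁ + 1 / 4 * Real.log k₄ +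
      (k₂ / 4 + 1 / 2) * Real.log M - 1 / 2 * Real.log t +
      (k₃ + k₅) / 4 * Real.log (Real.log M) := by
    set A₀ : ℝ := 2 * Real.log k₁ - Real.log k₄ + (2 * k₂ + 1) * Real.log M - Real.log t +
      (2 * k₃ - k₅) * Real.log (Real.log M) with hA₀
    set A₁ : ℝ := -2 * Real.log k₁ + 2 * Real.log k₄ - 2 * k₂ * Real.log M +
      (2 * k₅ - 2 * k₃) * Real.log (Real.log M) with hA₁
    have e : ∫ σ in (1 / 2 : ℝ)..1, BA σ = ∫ σ in (1 / 2 : ℝ)..1, (A₀ + σ * A₁) := by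
      refine intervalIntegral.integral_congr fun σ _ ↦ ?_
      simp only [hBA, hA₀, hA₁]; ring
    have hii : IntervalIntegrable (fun σ : ℝ ↦ σ * A₁) volume (1 / 2) 1 :=
      (continuous_id.mul continuous_const).intervalIntegrable _ _
    rw [e, intervalIntegral.integral_add (f := fun _ ↦ A₀) (g := fun σ : ℝ ↦ σ * A₁)
        intervalIntegrable_const hii,
      intervalIntegral.integral_const, intervalIntegral.integral_mul_const, integral_id]
    simp only [smul_eq_mul, hA₀, hA₁]
    ring
  have hvalB : ∫ σ in (1 : ℝ)..(1 + δ), BB σ = δ / 2 * Real.log k₄ + δ / 2 * Real.log Bc +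
      δ * (Real.log M - Real.log t) + k₅ * δ / 2 * Real.log (Real.log M) := by
    have hδ0 : δ ≠ 0 := hδ.ne'
    set A₀ : ℝ := (1 + δ) / δ * Real.log k₄ - 1 / δ * Real.log Bc + (Real.log M - Real.log t) +
      k₅ * ((1 + δ) / δ) * Real.log (Real.log M) with hA₀
    set A₁ : ℝ := -(1 / δ) * Real.log k₄ + 1 / δ * Real.log Bc -
      k₅ / δ * Real.log (Real.log M) with hA₁
    have e : ∫ σ in (1 : ℝ)..(1 + δ), BB σ = ∫ σ in (1 : ℝ)..(1 + δ), (A₀ + σ * A₁) := by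
      refine intervalIntegral.integral_congr fun σ _ ↦ ?_
      simp only [hBB, hA₀, hA₁]; field_simp; ring
    have hii : IntervalIntegrable (fun σ : ℝ ↦ σ * A₁) volume 1 (1 + δ) :=
      (continuous_id.mul continuous_const).intervalIntegrable _ _
    rw [e, intervalIntegral.integral_add (f := fun _ ↦ A₀) (g := fun σ : ℝ ↦ σ * A₁)
        intervalIntegrable_const hii,
      intervalIntegral.integral_const, intervalIntegral.integral_mul_const, integral_id]
    simp only [smul_eq_mul, hA₀, hA₁]
    field_simp
    ring
  rw [hsplit]
  rw [hvalA] at hmonoA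
  rw [hvalB] at hmonoB
  have hsum : (1 / 4 * Real.log k₁ + 1 / 4 * Real.log k₄ + (k₂ / 4 + 1 / 2) * Real.log M -
      1 / 2 * Real.log t + (k₃ + k₅) / 4 * Real.log (Real.log M)) +
      ((δ / 2 * Real.log k₄ + δ / 2 * Real.log Bc + δ * (Real.log M - Real.log t) +
        k₅ * δ / 2 * Real.log (Real.log M)) + ∫ σ in Ioi (1 + δ), Real.log ‖riemannZeta σ‖) =
      (∫ σ in Ioi (1 + δ), Real.log ‖riemannZeta σ‖) + 1 / 4 * Real.log k₁ +
        (1 / 4 + δ / 2) * Real.log k₄ + δ / 2 * Real.log Bc + k₂ / 4 * Real.log M +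
        (1 / 2 + δ) * (Real.log M - Real.log t) +
        ((k₃ + k₅) / 4 + k₅ * δ / 2) * Real.log (Real.log M) := by ring
  linarith


/-- `log (x + η) ≤ log x + η/x` for `x > 0`, `η ≥ 0` (`log(1+u) ≤ u`). [folklore] -/
theorem log_add_le_log_add_div {x η : ℝ} (hx : 0 < x) (hη : 0 ≤ η) :
    Real.log (x + η) ≤ Real.log x + η / x := by
  have hxη : 0 < x + η := by linarith
  have h := Real.log_le_sub_one_of_pos (div_pos hxη hx)
  rw [Real.log_div hxη.ne' hx.ne'] at h
  have e : (x + η) / x - 1 = η / x := by field_simp; ring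
  linarith

open MeasureTheory in
/-- **Trudgian 2016, Lemma 2, in the form `A₁ + B₁ log log t + C₁ log t`.**  Under the hypotheses of
`setIntegral_Ioi_half_log_norm_riemannZeta_le_trudgianII`, for `t > t₀ > 1` not an ordinate, with
`η = (Q₀+1+δ)²/(2t₀²)`, `B₁ = (k₃+k₅)/4 + k₅δ/2`, `C₁ = k₂/4` and
`A₁ = ∫_{1+δ}^∞ log ζ(σ) dσ + ¼ log k₁ + (¼ + δ/2) log k₄ + (δ/2) log ζ(1+δ) + (k₂/4 + ½ + δ) η + B₁ η/log t₀`: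
`∫_{1/2}^∞ log|ζ(σ+it)| dσ ≤ A₁ + B₁ log log t + C₁ log t`
(`log M ≤ log t + η`, `log log M ≤ log log t + η/log t₀` for `M = |Q₀+1+δ+it|`).  The printed `A₁`
has instead the (larger) terms `(k₂/4 + ½ + δ) log(1 + a₁)` and `B₁ log(1 + a₀)`,
`a₁ = (1+δ+Q₀)/t₀`, `a₀ ≥ π/(2 log t₀)`; `B₁`, `C₁` are as printed. [cite: Trudgian2016, Lemma 2] -/
theorem setIntegral_Ioi_half_log_norm_riemannZeta_le_trudgianII' {k₁ k₂ k₃ k₄ k₅ Q₀ δ t₀ t : ℝ}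
    (hk₁ : 0 < k₁) (hk₂ : 0 ≤ k₂) (hk₃ : 0 ≤ k₃) (hk₄ : 0 < k₄) (hk₅ : 0 ≤ k₅)
    (hQ₀ : 1 / 2 < Q₀) (hδ : 0 < δ) (hk : k₅ - k₃ ≤ k₂ * Real.log (Q₀ + 1 / 2))
    (H1 : ∀ u : ℝ, ‖riemannZeta₁ (1 / 2 + u * I)‖ ≤
      k₁ * ‖(Q₀ : ℂ) + (1 / 2 + u * I)‖ ^ (k₂ + 1) * Real.log ‖(Q₀ : ℂ) + (1 / 2 + u * I)‖ ^ k₃)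
    (H2 : ∀ u : ℝ, ‖riemannZeta₁ (1 + u * I)‖ ≤
      k₄ * ‖(Q₀ : ℂ) + (1 + u * I)‖ * Real.log ‖(Q₀ : ℂ) + (1 + u * I)‖ ^ k₅)
    (ht₀ : 1 < t₀) (ht : t₀ < t) (hord : ∀ ρ : ℂ, riemannZeta ρ = 0 → ρ.im ≠ t) :
    ∫ σ in Ioi (1 / 2 : ℝ), Real.log ‖riemannZeta (σ + t * I)‖ ≤
      ((∫ σ in Ioi (1 + δ), Real.log ‖riemannZeta σ‖) + 1 / 4 * Real.log k₁ +
        (1 / 4 + δ / 2) * Real.log k₄ + δ / 2 * Real.log (riemannZeta ((1 + δ : ℝ) : ℂ)).re +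
        (k₂ / 4 + 1 / 2 + δ) * ((Q₀ + 1 + δ) ^ 2 / (2 * t₀ ^ 2)) +
        ((k₃ + k₅) / 4 + k₅ * δ / 2) * ((Q₀ + 1 + δ) ^ 2 / (2 * t₀ ^ 2) / Real.log t₀)) +
      ((k₃ + k₅) / 4 + k₅ * δ / 2) * Real.log (Real.log t) + k₂ / 4 * Real.log t := by
  have ht0 : 0 < t := by linarith
  have h := setIntegral_Ioi_half_log_norm_riemannZeta_le_trudgianII hk₁ hk₂ hk₃ hk₄ hk₅ hQ₀ hδ hk
    H1 H2 ht0 hord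
  set M : ℝ := ‖((Q₀ + 1 + δ : ℝ) : ℂ) + t * I‖ with hM
  set η : ℝ := (Q₀ + 1 + δ) ^ 2 / (2 * t₀ ^ 2) with hη
  set B₁ : ℝ := (k₃ + k₅) / 4 + k₅ * δ / 2 with hB₁
  have hB₁0 : 0 ≤ B₁ := by positivity
  have hη0 : 0 ≤ η := by positivity
  have hMt : t ≤ M := by
    have := abs_im_le_norm (((Q₀ + 1 + δ : ℝ) : ℂ) + t * I)
    simp only [add_im, ofReal_im, mul_im, I_re, I_im, ofReal_re, mul_zero, mul_one, zero_add,
      add_zero] at this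
    rw [abs_of_pos ht0] at this
    simpa [hM] using this
  have hM0 : 0 < M := ht0.trans_le hMt
  have hlogt0 : 0 < Real.log t₀ := Real.log_pos ht₀
  have hlogt : Real.log t₀ ≤ Real.log t := Real.log_le_log (by linarith) ht.le
  have hlogt' : 0 < Real.log t := hlogt0.trans_le hlogt
  have hfrac : (Q₀ + 1 + δ) ^ 2 / (2 * t ^ 2) ≤ η := by
    rw [hη]; gcongr
  have hlogM : Real.log M ≤ Real.log t + η :=
    (log_norm_add_mul_I_le _ ht0).trans (by linarith)
  have hllM : Real.log (Real.log M) ≤ Real.log (Real.log t) + η / Real.log t₀ := by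
    have h1 : Real.log (Real.log M) ≤ Real.log (Real.log t + η) :=
      Real.log_le_log (Real.log_pos (by linarith)) hlogM
    have h2 := log_add_le_log_add_div hlogt' hη0
    have h3 : η / Real.log t ≤ η / Real.log t₀ := div_le_div_of_nonneg_left hη0 hlogt0 hlogt
    linarith
  have e1 : k₂ / 4 * Real.log M ≤ k₂ / 4 * (Real.log t + η) :=
    mul_le_mul_of_nonneg_left hlogM (by positivity)
  have e2 : (1 / 2 + δ) * (Real.log M - Real.log t) ≤ (1 / 2 + δ) * η :=
    mul_le_mul_of_nonneg_left (by linarith) (by positivity)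
  have e3 : B₁ * Real.log (Real.log M) ≤ B₁ * (Real.log (Real.log t) + η / Real.log t₀) :=
    mul_le_mul_of_nonneg_left hllM hB₁0
  have e4 : k₂ / 4 * (Real.log t + η) + (1 / 2 + δ) * η + B₁ * (Real.log (Real.log t) + η / Real.log t₀)
      = (k₂ / 4 + 1 / 2 + δ) * η + B₁ * (η / Real.log t₀) + B₁ * Real.log (Real.log t) +
        k₂ / 4 * Real.log t := by ring
  linarith

open MeasureTheory in
/-- **Trudgian 2016, Theorem 2, modulo the lower bound** (the glue of the paper's proof, proved):
under the edge hypotheses `H1`, `H2` of [Trudgian 2016, Lemma 1] (parameters as in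
`setIntegral_Ioi_half_log_norm_riemannZeta_le_trudgianII`) and *any* lower bound
`−∫_{1/2}^∞ log|ζ(σ+it)| dσ ≤ a₂ + c₂ log t` for the non-ordinates `t > t₀ > 1` (`c₂ ≥ 0`; in the
paper: [Trudgian 2011, Lemma 2.11], `c₂ = (d²/2)(log 4 − 1)`), one has for all `t₀ < t₁ ≤ t₂`
`|∫_{t₁}^{t₂} S(t) dt| ≤ (A₁ + a₂)/π + (B₁/π) log log t₂ + ((k₂/4 + c₂)/π) log t₂`
with `A₁, B₁` as in `setIntegral_Ioi_half_log_norm_riemannZeta_le_trudgianII'` — i.e. the printed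
`πb = (k₃+k₅)/4 + δk₅/2`, `πc = k₂/4 + (d²/2)(log 4 − 1)`, and `πa ≤` the printed (7).
(`abs_integral_zetaArgS_le_of_bounds_loglog` + the previous theorem.) [cite: Trudgian2016, Thm 2] -/
theorem abs_integral_zetaArgS_le_trudgianII_of_lower {k₁ k₂ k₃ k₄ k₅ Q₀ δ t₀ a₂ c₂ : ℝ}
    (hk₁ : 0 < k₁) (hk₂ : 0 ≤ k₂) (hk₃ : 0 ≤ k₃) (hk₄ : 0 < k₄) (hk₅ : 0 ≤ k₅)
    (hQ₀ : 1 / 2 < Q₀) (hδ : 0 < δ) (hk : k₅ - k₃ ≤ k₂ * Real.log (Q₀ + 1 / 2))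
    (H1 : ∀ u : ℝ, ‖riemannZeta₁ (1 / 2 + u * I)‖ ≤
      k₁ * ‖(Q₀ : ℂ) + (1 / 2 + u * I)‖ ^ (k₂ + 1) * Real.log ‖(Q₀ : ℂ) + (1 / 2 + u * I)‖ ^ k₃)
    (H2 : ∀ u : ℝ, ‖riemannZeta₁ (1 + u * I)‖ ≤
      k₄ * ‖(Q₀ : ℂ) + (1 + u * I)‖ * Real.log ‖(Q₀ : ℂ) + (1 + u * I)‖ ^ k₅)
    (ht₀ : 1 < t₀) (hc₂ : 0 ≤ c₂)
    (hL : ∀ t : ℝ, t₀ < t → (∀ ρ : ℂ, riemannZeta ρ = 0 → ρ.im ≠ t) →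
      -(∫ x in Ioi (1 / 2 : ℝ), Real.log ‖riemannZeta (x + t * I)‖) ≤ a₂ + c₂ * Real.log t)
    {t₁ t₂ : ℝ} (h₁ : t₀ < t₁) (h12 : t₁ ≤ t₂) :
    |∫ t in t₁..t₂, zetaArgS t| ≤
      (((∫ σ in Ioi (1 + δ), Real.log ‖riemannZeta σ‖) + 1 / 4 * Real.log k₁ +
        (1 / 4 + δ / 2) * Real.log k₄ + δ / 2 * Real.log (riemannZeta ((1 + δ : ℝ) : ℂ)).re +
        (k₂ / 4 + 1 / 2 + δ) * ((Q₀ + 1 + δ) ^ 2 / (2 * t₀ ^ 2)) +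
        ((k₃ + k₅) / 4 + k₅ * δ / 2) * ((Q₀ + 1 + δ) ^ 2 / (2 * t₀ ^ 2) / Real.log t₀)) + a₂) / π +
      ((k₃ + k₅) / 4 + k₅ * δ / 2) / π * Real.log (Real.log t₂) +
      (k₂ / 4 + c₂) / π * Real.log t₂ :=
  abs_integral_zetaArgS_le_of_bounds_loglog ht₀.le (by positivity) (by positivity) hc₂
    (fun t ht hn ↦ setIntegral_Ioi_half_log_norm_riemannZeta_le_trudgianII' hk₁ hk₂ hk₃ hk₄ hk₅
      hQ₀ hδ hk H1 H2 ht₀ ht hn) hL h₁ h12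


/-! ### The target fact from the four remaining inputs (Trudgian 2016, Thm 1 ⇐ Thm 2, row `T = 10¹⁰`) -/

open MeasureTheory in
/-- **Trudgian 2016, Theorem 1 from its inputs** (the row `T = 10¹⁰`, `d = 0.762`, `δ = 0.148` of
Table 1, with `(k₁, k₂, k₃, k₄, k₅, Q₀) = (0.732, 1/6, 1, 3/4, 1, 5)`, eq. (8)).  The named fact
`Literature.NumberTheory.LFunctions.abs_integral_zetaArgS_le_trudgianII` follows from:
* `H1`: `|ζ₁(½+iu)| ≤ 0.732 |5.5+iu|^{7/6} log|5.5+iu|` for all real `u` — from Platt–Trudgian 2015,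
  `|ζ(½+it)| ≤ 0.732 |4.678+it|^{1/6} log|4.678+it|` (all `t`), and `|s−1| ≤ |Q₀+s|`;
* `H2`: `|ζ₁(1+iu)| ≤ ¾ |6+iu| log|6+iu|` for all real `u` — from Trudgian 2014,
  `|ζ(1+it)| ≤ ¾ log t` (`t ≥ 3`), plus an elementary bound for `|t| < 3`;
* `hL`: the lower bound of [Trudgian 2011, Lemma 2.11] at `d = 0.762` for `t > 10⁵`
  (`b₂ = (d²/2)(log 4 − 1)`), with constant `a₂`;
* `hnum`: one numerical inequality, `A₁ + a₂ ≤ 1.698 π` (`A₁` of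
  `setIntegral_Ioi_half_log_norm_riemannZeta_le_trudgianII'`; it involves `∫_{1.148}^∞ log ζ(σ) dσ`
  and `ζ(1.148)`).
The coefficients `0.183 ≥ 0.574/π` and `0.049 ≥ (1/24 + (0.762²/2)(log 4 − 1))/π` are checked here.
[cite: Trudgian2016, Thm 1, Thm 2, Table 1] -/
theorem abs_integral_zetaArgS_le_trudgianII_of
    (H1 : ∀ u : ℝ, ‖riemannZeta₁ (1 / 2 + u * I)‖ ≤
      0.732 * ‖(5 : ℂ) + (1 / 2 + u * I)‖ ^ (7 / 6 : ℝ) * Real.log ‖(5 : ℂ) + (1 / 2 + u * I)‖)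
    (H2 : ∀ u : ℝ, ‖riemannZeta₁ (1 + u * I)‖ ≤
      3 / 4 * ‖(5 : ℂ) + (1 + u * I)‖ * Real.log ‖(5 : ℂ) + (1 + u * I)‖)
    {a₂ : ℝ}
    (hL : ∀ t : ℝ, (10 : ℝ) ^ 5 < t → (∀ ρ : ℂ, riemannZeta ρ = 0 → ρ.im ≠ t) →
      -(∫ x in Ioi (1 / 2 : ℝ), Real.log ‖riemannZeta (x + t * I)‖) ≤
        a₂ + (0.762 ^ 2 / 2 * (Real.log 4 - 1)) * Real.log t)
    (hnum : (∫ σ in Ioi (1 + 0.148 : ℝ), Real.log ‖riemannZeta σ‖) + 1 / 4 * Real.log 0.732 +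
        (1 / 4 + 0.148 / 2) * Real.log (3 / 4) +
        0.148 / 2 * Real.log (riemannZeta ((1 + 0.148 : ℝ) : ℂ)).re +
        ((1 / 6 : ℝ) / 4 + 1 / 2 + 0.148) * ((5 + 1 + 0.148) ^ 2 / (2 * ((10 : ℝ) ^ 5) ^ 2)) +
        ((1 + 1) / 4 + 1 * 0.148 / 2) * ((5 + 1 + 0.148) ^ 2 / (2 * ((10 : ℝ) ^ 5) ^ 2) /
          Real.log ((10 : ℝ) ^ 5)) + a₂ ≤ 1.698 * π) :
    abs_integral_zetaArgS_le_trudgianII := by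
  intro t₁ t₂ h1 h12
  have hlog2 := Real.log_two_lt_d9
  have hlog2' := Real.log_two_gt_d9
  have hlog4 : Real.log 4 = 2 * Real.log 2 := by
    rw [show (4 : ℝ) = 2 ^ 2 by norm_num, Real.log_pow]; push_cast; ring
  have hc₂ : 0 ≤ 0.762 ^ 2 / 2 * (Real.log 4 - 1) := by
    have : 1 ≤ Real.log 4 := by rw [hlog4]; linarith
    have : (0 : ℝ) ≤ 0.762 ^ 2 / 2 := by norm_num
    positivity
  -- the edge hypotheses in the parametrised shape
  have H1' : ∀ u : ℝ, ‖riemannZeta₁ (1 / 2 + u * I)‖ ≤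
      0.732 * ‖((5 : ℝ) : ℂ) + (1 / 2 + u * I)‖ ^ ((1 / 6 : ℝ) + 1) *
        Real.log ‖((5 : ℝ) : ℂ) + (1 / 2 + u * I)‖ ^ (1 : ℝ) := by
    intro u
    rw [Real.rpow_one, show ((1 / 6 : ℝ) + 1) = 7 / 6 by norm_num]
    exact_mod_cast H1 u
  have H2' : ∀ u : ℝ, ‖riemannZeta₁ (1 + u * I)‖ ≤
      3 / 4 * ‖((5 : ℝ) : ℂ) + (1 + u * I)‖ * Real.log ‖((5 : ℝ) : ℂ) + (1 + u * I)‖ ^ (1 : ℝ) := by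
    intro u
    rw [Real.rpow_one]
    exact_mod_cast H2 u
  have hk : (1 : ℝ) - 1 ≤ 1 / 6 * Real.log (5 + 1 / 2) := by
    have : 0 ≤ Real.log (5 + 1 / 2) := Real.log_nonneg (by norm_num)
    linarith
  have hglue := abs_integral_zetaArgS_le_trudgianII_of_lower (k₁ := 0.732) (k₂ := 1 / 6) (k₃ := 1)
    (k₄ := 3 / 4) (k₅ := 1) (Q₀ := 5) (δ := 0.148) (t₀ := (10 : ℝ) ^ 5) (a₂ := a₂)
    (c₂ := 0.762 ^ 2 / 2 * (Real.log 4 - 1)) (by norm_num) (by norm_num) (by norm_num)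
    (by norm_num) (by norm_num) (by norm_num) (by norm_num) hk H1' H2' (by norm_num) hc₂ hL h1 h12.le
  refine hglue.trans ?_
  -- the three coefficient inequalities
  have hπ := Real.pi_gt_d6
  have hπ0 : 0 < π := Real.pi_pos
  have ht₂ : (10 : ℝ) ^ 5 < t₂ := h1.trans h12
  have hlogt₂ : 1 < Real.log t₂ := by
    have he : Real.exp 1 < t₂ := lt_trans (lt_trans Real.exp_one_lt_d9 (by norm_num)) ht₂
    have := Real.log_lt_log (Real.exp_pos 1) he
    rwa [Real.log_exp] at this
  have hlt : 0 ≤ Real.log t₂ := by linarith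
  have hll : 0 ≤ Real.log (Real.log t₂) := Real.log_nonneg hlogt₂.le
  have i1 : ((∫ σ in Ioi (1 + 0.148 : ℝ), Real.log ‖riemannZeta σ‖) + 1 / 4 * Real.log 0.732 +
        (1 / 4 + 0.148 / 2) * Real.log (3 / 4) +
        0.148 / 2 * Real.log (riemannZeta ((1 + 0.148 : ℝ) : ℂ)).re +
        ((1 / 6 : ℝ) / 4 + 1 / 2 + 0.148) * ((5 + 1 + 0.148) ^ 2 / (2 * ((10 : ℝ) ^ 5) ^ 2)) +
        ((1 + 1) / 4 + 1 * 0.148 / 2) * ((5 + 1 + 0.148) ^ 2 / (2 * ((10 : ℝ) ^ 5) ^ 2) /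
          Real.log ((10 : ℝ) ^ 5)) + a₂) / π ≤ 1.698 := by
    rw [div_le_iff₀ hπ0]; exact hnum
  have i2 : ((1 + 1) / 4 + 1 * 0.148 / 2) / π ≤ (0.183 : ℝ) := by
    rw [div_le_iff₀ hπ0]; nlinarith
  have i3 : (1 / 6 / 4 + 0.762 ^ 2 / 2 * (Real.log 4 - 1)) / π ≤ (0.049 : ℝ) := by
    rw [div_le_iff₀ hπ0, hlog4]; nlinarith
  nlinarith [mul_le_mul_of_nonneg_right i2 hll, mul_le_mul_of_nonneg_right i3 hlt]


/-! ### The edge hypotheses `H1`, `H2` from bounds in their published shapes -/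

/-- **`H1` from a critical-line bound of Platt–Trudgian shape.**  If
`|ζ(½+it)| ≤ k₁ |Q+it|^{k₂} (log|Q+it|)^{k₃}` for all real `t` (`k₁, k₂, k₃ ≥ 0`, `1 ≤ Q ≤ Q₀ + ½`;
[PlattTrudgian2015, Cor. 2] is `k₁ = 0.732`, `k₂ = 1/6`, `k₃ = 1`, any `Q ≥ 4.678`), then
`|ζ₁(½+iu)| ≤ k₁ |Q₀+½+iu|^{k₂+1} (log|Q₀+½+iu|)^{k₃}` for all real `u` — the first edge hypothesis of
[Trudgian2016, Lemma 1] (`|s−1| = |−½+iu| ≤ |Q₀+½+iu|`, and `x ↦ x^{k₂}(log x)^{k₃}` is monotone on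
`x ≥ 1`). [cite: Trudgian2016, Lemma 1 and Cor. 1 (proof)] -/
theorem norm_riemannZeta₁_half_line_le_of_shifted {k₁ k₂ k₃ Q Q₀ : ℝ} (hk₁ : 0 ≤ k₁) (hk₂ : 0 ≤ k₂)
    (hk₃ : 0 ≤ k₃) (hQ : 1 ≤ Q) (hQQ₀ : Q ≤ Q₀ + 1 / 2)
    (h : ∀ t : ℝ, ‖riemannZeta (1 / 2 + t * I)‖ ≤
      k₁ * ‖(Q : ℂ) + t * I‖ ^ k₂ * Real.log ‖(Q : ℂ) + t * I‖ ^ k₃) (u : ℝ) :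
    ‖riemannZeta₁ (1 / 2 + u * I)‖ ≤
      k₁ * ‖(Q₀ : ℂ) + (1 / 2 + u * I)‖ ^ (k₂ + 1) * Real.log ‖(Q₀ : ℂ) + (1 / 2 + u * I)‖ ^ k₃ := by
  set s : ℂ := 1 / 2 + u * I with hs
  set N : ℝ := ‖(Q₀ : ℂ) + s‖ with hN
  set NQ : ℝ := ‖(Q : ℂ) + u * I‖ with hNQ
  have hs1 : s ≠ 1 := fun h' ↦ by
    have := congrArg Complex.re h'; norm_num [hs] at this
  have hNQ1 : 1 ≤ NQ := by
    refine le_trans hQ (le_trans ?_ (abs_re_le_norm _))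
    simp only [add_re, ofReal_re, mul_re, I_re, I_im, ofReal_im, mul_zero, mul_one, sub_self,
      add_zero]
    exact le_abs_self _
  have hNQ0 : 0 < NQ := by linarith
  have hNQN : NQ ≤ N := by
    have e1 : (Q₀ : ℂ) + s = ((Q₀ + 1 / 2 : ℝ) : ℂ) + u * I := by simp [hs]; ring
    rw [hN, e1, hNQ, Complex.norm_add_mul_I, Complex.norm_add_mul_I]
    exact Real.sqrt_le_sqrt (by nlinarith)
  have hN0 : 0 < N := by linarith
  have hsm1 : ‖s - 1‖ ≤ N := by
    have e1 : s - 1 = ((-(1 / 2) : ℝ) : ℂ) + u * I := by simp [hs]; ring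
    have e2 : (Q₀ : ℂ) + s = ((Q₀ + 1 / 2 : ℝ) : ℂ) + u * I := by simp [hs]; ring
    rw [e1, hN, e2, Complex.norm_add_mul_I, Complex.norm_add_mul_I]
    exact Real.sqrt_le_sqrt (by nlinarith)
  have hlogQ : 0 ≤ Real.log NQ := Real.log_nonneg hNQ1
  have hlog : Real.log NQ ≤ Real.log N := Real.log_le_log hNQ0 hNQN
  have hζ := h u
  rw [LFunctions.riemannZeta₁_eq_mul hs1, norm_mul, Real.rpow_add hN0, Real.rpow_one]
  calc ‖s - 1‖ * ‖riemannZeta s‖ ≤ N * (k₁ * NQ ^ k₂ * Real.log NQ ^ k₃) :=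
        mul_le_mul hsm1 hζ (norm_nonneg _) hN0.le
    _ ≤ N * (k₁ * N ^ k₂ * Real.log N ^ k₃) := by
        gcongr
    _ = k₁ * (N ^ k₂ * N) * Real.log N ^ k₃ := by ring

/-- **`H2` from a bound on the line `σ = 1` for `t ≥ T` plus a bound for `|t| < T`.**  If
`|ζ(1+it)| ≤ k₄ (log t)^{k₅}` for `t ≥ T ≥ 1` ([TrudgianZetaOne2014]: `k₄ = ¾`, `k₅ = 1`, `T = 3`) and
`|ζ₁(1+iu)| ≤ k₄ (Q₀+1) (log(Q₀+1))^{k₅}` for `|u| < T` (`Q₀ ≥ 0`), then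
`|ζ₁(1+iu)| ≤ k₄ |Q₀+1+iu| (log|Q₀+1+iu|)^{k₅}` for all real `u` — the second edge hypothesis of
[Trudgian2016, Lemma 1] (negative `u` by `ζ(s̄) = conj ζ(s)`; `|u| ≤ |Q₀+1+iu|`).
[cite: Trudgian2016, Lemma 1 and Cor. 1 (proof)] -/
theorem norm_riemannZeta₁_one_line_le_of {k₄ k₅ Q₀ T : ℝ} (hk₄ : 0 ≤ k₄) (hk₅ : 0 ≤ k₅)
    (hQ₀ : 0 ≤ Q₀) (hT : 1 ≤ T)
    (hlarge : ∀ t : ℝ, T ≤ t → ‖riemannZeta (1 + t * I)‖ ≤ k₄ * Real.log t ^ k₅)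
    (hsmall : ∀ u : ℝ, |u| < T →
      ‖riemannZeta₁ (1 + u * I)‖ ≤ k₄ * (Q₀ + 1) * Real.log (Q₀ + 1) ^ k₅) (u : ℝ) :
    ‖riemannZeta₁ (1 + u * I)‖ ≤
      k₄ * ‖(Q₀ : ℂ) + (1 + u * I)‖ * Real.log ‖(Q₀ : ℂ) + (1 + u * I)‖ ^ k₅ := by
  set s : ℂ := 1 + u * I with hs
  set N : ℝ := ‖(Q₀ : ℂ) + s‖ with hN
  have e2 : (Q₀ : ℂ) + s = ((Q₀ + 1 : ℝ) : ℂ) + u * I := by simp [hs]; ring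
  have hNre : Q₀ + 1 ≤ N := by
    rw [hN, e2]
    refine le_trans ?_ (abs_re_le_norm _)
    simp only [add_re, ofReal_re, mul_re, I_re, I_im, ofReal_im, mul_zero, mul_one, sub_self,
      add_zero]
    exact le_abs_self _
  have hNu : |u| ≤ N := by
    rw [hN, e2]
    refine le_trans ?_ (abs_im_le_norm _)
    simp
  have hN1 : 1 ≤ N := by linarith
  have hN0 : 0 < N := by linarith
  have hlogN0 : 0 ≤ Real.log N := Real.log_nonneg hN1
  rcases lt_or_ge |u| T with hu | hu
  · -- small `|u|`
    calc ‖riemannZeta₁ s‖ ≤ k₄ * (Q₀ + 1) * Real.log (Q₀ + 1) ^ k₅ := hsmall u hu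
      _ ≤ k₄ * N * Real.log N ^ k₅ := by
          have hl : Real.log (Q₀ + 1) ≤ Real.log N := Real.log_le_log (by linarith) hNre
          have hl0 : 0 ≤ Real.log (Q₀ + 1) := Real.log_nonneg (by linarith)
          gcongr
  · -- `|u| ≥ T ≥ 1`: reduce to `u > 0` by conjugation
    have hu1 : 1 ≤ |u| := hT.trans hu
    have hs1 : s ≠ 1 := fun h' ↦ by
      have := congrArg Complex.im h'; simp [hs] at this; rw [this] at hu1; simp at hu1; linarith
    have hζ : ‖riemannZeta s‖ ≤ k₄ * Real.log |u| ^ k₅ := by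
      rcases le_or_gt 0 u with hu0 | hu0
      · have := hlarge u (by rwa [abs_of_nonneg hu0] at hu)
        rwa [abs_of_nonneg hu0]
      · have h' := hlarge (-u) (by rwa [abs_of_neg hu0] at hu)
        have hc : (1 + ((-u : ℝ) : ℂ) * I) = starRingEnd ℂ s := by
          apply Complex.ext <;> simp [hs]
        rw [hc, riemannZeta_conj, Complex.norm_conj] at h'
        rwa [abs_of_neg hu0]
    have hsm1 : ‖s - 1‖ = |u| := by
      have : s - 1 = u * I := by simp [hs]
      rw [this, norm_mul, Complex.norm_I, mul_one, Complex.norm_real, Real.norm_eq_abs]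
    have hlogu0 : 0 ≤ Real.log |u| := Real.log_nonneg hu1
    have hlogu : Real.log |u| ≤ Real.log N := Real.log_le_log (by linarith) hNu
    rw [LFunctions.riemannZeta₁_eq_mul hs1, norm_mul, hsm1]
    calc |u| * ‖riemannZeta s‖ ≤ N * (k₄ * Real.log |u| ^ k₅) :=
          mul_le_mul hNu hζ (norm_nonneg _) hN0.le
      _ ≤ N * (k₄ * Real.log N ^ k₅) := by
          gcongr
      _ = k₄ * N * Real.log N ^ k₅ := by ring

end Literature.NumberTheory.LFunctions

end
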